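import Summits.NavierStokesRegularity.NavierStokesRegularity.Theorems.ExtremiserTransienceNearExtremalTransienceExtremiserLiouvillePlateau
import Summits.NavierStokesRegularity.NavierStokesRegularity.Theorems.ExtremiserTransiencePlateauSliceRigidity
import Summits.NavierStokesRegularity.NavierStokesRegularity.Theorems.ExtremiserTransienceKStarAttainedHalfSpaceVariation
import Summits.NavierStokesRegularity.NavierStokesRegularity.Theorems.ExtremiserTransiencePerFlowScaleLock
import Literature.Analysis.FluidPDE.TypeIAncientMild
import Literature.Analysis.FluidPDE.BarkerPrange2020VorticityAlignmentTypeIHolds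
import Summits.NavierStokesRegularity.NavierStokesRegularity.Theorems.ExtremiserTransiencePeriodicFilamentLiouville
import Summits.NavierStokesRegularity.NavierStokesRegularity.Theorems.ClockStretchingLawSteadySliceLiouvilleAnalytic
import Literature.Analysis.FluidPDE.TypeIAncientMildRescale
import Literature.Analysis.FluidPDE.AxisymmetricVorticityTransport
import Summits.NavierStokesRegularity.NavierStokesRegularity.Theorems.SymmetryModuliCountSymmetricLiouville
import Summits.NavierStokesRegularity.NavierStokesRegularity.Theorems.ExtremiserTransienceNearExtremalTransiencePerFlowStubZoomPackageFlow
import Summits.NavierStokesRegularity.NavierStokesRegularity.Theorems.ExtremiserTransienceNearExtremalTransiencePerFlowStubGrowthTransferFlow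
import Summits.NavierStokesRegularity.NavierStokesRegularity.Theorems.LiouvilleConjectureNS
import Summits.NavierStokesRegularity.NavierStokesRegularity.Theorems.ExtremiserTransienceBangBangCoreDefs
import Summits.NavierStokesRegularity.NavierStokesRegularity.Theorems.ExtremiserTransienceNearExtremalTransiencePerFlowStubFlowFilamentBudget
import Summits.NavierStokesRegularity.NavierStokesRegularity.Theorems.ExtremiserTransienceNearExtremalTransiencePerFlowStubGrowthTransfer
import Summits.NavierStokesRegularity.NavierStokesRegularity.Theorems.ExtremiserTransienceNearExtremalTransiencePerFlowMemberSelectionStubZoomPackage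
import Summits.NavierStokesRegularity.NavierStokesRegularity.Theorems.ExtremiserTransienceScrewSymmetricLiouville
import HarnessLib

/-!
# LINE g9-β «filament selection» — crux `NearExtremalTransiencePerFlow` (item stmt-NavierStokesRegularity-26567)

Route `ExtremiserTransience` (ideator seat ns-idea-5, generation g9, technique card «extremal-example mining»).  HONEST FRAMING:
a crux WORKFILE (KEY-NS #155 (1): files only, not the registered skeleton of record) with FIVE registered stubs (rev 4: TWO `sorry`s = T1, H on the canonical path; F1, G, T2 are DISCHARGED BY NAME by the
landed theorems `…FilamentGap.flowFilamentBudget` p684070, `…FilamentSelection.growthTransfer` p685102 (both prover ns-net-p2 g5) and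
`…MemberSelection.stub_zoomPackage` p665546 (δ line, ns-net-p1)) of which THREE are
VERBATIM COPIES of stubs of the filed lines g9-α `filament_gap` (F1) and g7-δ `member_selection` (T1, T2) — crux workfiles are not
importable modules, so the shared statements are restated letter for letter (same normalised signatures; staffed once) — and TWO are
new (G glue, H heart), plus a kernel-checked composition ending in the crux BY NAME.  Nothing about Navier–Stokes regularity or
blow-up is proved here; no summit is proved by a line.

## Idea (one paragraph)
The MEET of the two live lines.  g9-α feeds the Type-I FILAMENT BUDGET F1 (`∫_{B(x,r)}|u(t)|² ≤ A·ν²·r` for all centres, all radii and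
all late times — Seregin's bounded scaled energy for sup-norm Type-I flows) into a STATIC gap (F2 `ChainGap`, open, refutable by kit
j321232); g7-δ feeds the near-extremal zoomed slices into a COHERENT SELECTION (T1) whose limit is a slice `W s` of a Type-I ancient
mild field (T2, KNSS zoom) that is exactly extremal (killed by the landed plateau rigidity) or a TUBE SLICE, excluded by δ's dynamic
heart T3 `NoTubeSlice` — a Liouville-type statement over ALL Type-I ancient mild fields, sheets and volume crowds included.  The
observation of this line: F1 passes through δ's zoom WITH THE SAME CONSTANT and survives pointwise limits of translates
(`∫_{B(x,R)}|v_n|² ≤ A·R` for the NS-compatible zoom `y ↦ M⁻¹u(t,(ν/M)y)` is the scale-invariance of `r⁻¹∫_{B_r}|u|²`; dominated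
convergence on balls), so the limit tube slice is a FILAMENT: `∫_{B(x,R)}|W(s)|² ≤ A·R` for every `x, R`.  Hence δ's open heart may be
replaced by the strictly WEAKER `NoFilamentTubeSlice` (H): no slice of a Type-I ancient mild field that has linear local-energy growth is
a tube slice.  H sits below BOTH open hearts in play — below T3 (growth hypothesis added: the `κ⋆`-efficient sheets / 3D lattices of the
g8 instrument, which T3 must exclude by dynamics, are excluded here by ENERGY, a sheet having `∫_{B_R}|W|² ≍ R²` and a crowd `≍ R³`)
and below α's F2 (ancient NS dynamics and Type-I decay added: a static near-extremal necklace refutes F2 but not H unless it is also a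
slice of a Type-I ancient flow).  For ABSTRACT Type-I ancient mild fields linear growth at scales `R ≫ √(-s)` is NOT derivable (the
trivial bound is `K²R³/(-s)`; Seregin's iteration cannot be started from `R = ∞`) — the growth is inherited from the finite-energy flow,
which is why the budget must travel through the zoom rather than be proved at the limit.  What remains for H is the one enemy both
instruments point at: an infinite NECKLACE of `λ`-spaced near-top cells (linear growth, infinite budget, windowed efficiency `→ κ⋆`)
that is at the same time a slice of a Type-I ancient mild flow — a one-dimensional object with FINITE energy per unit length
(`sup_x R⁻¹∫_{B(x,R)}|W(s)|² ≤ A`), for which 2D-type Liouville tools (KNSS 2009 §§4–5) come back into range.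

## Stubs (the only `sorry`s) — F1, T1, T2 verbatim copies of filed stubs; G, H new
* F1 `stub_flowFilamentBudget`   — COPY of g9-α F1, PROVED in the tree (p684070 `flowFilamentBudget`; Seregin LN 2014 Prop 3.11(i) / SS09 L3.5 uniform form p682869).
* T1 `stub_coherentSelection`    — COPY of g7-δ T1 (slice-level selection; back end landed `coherentSelection_of_selectionData`; front end = INPUT WITH A NAMED WALL since 2026-08-29, see `CoherentSelectionZoom` (rev 15) for the form the compositions consume).
* T2 `stub_zoomPackage`          — COPY of g7-δ T2 (KNSS zoom glue on landed facts), CLOSED BY NAME by the landed δ theorem p665546 (rev 4).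
* G  `stub_growthTransfer`       — NEW glue (S/M): scale-invariance of `r⁻¹∫_{B_r}|u|²` under the NS zoom + dominated convergence on balls; PROVED p685102 (rev 4).
* H  `stub_noFilamentTubeSlice`  — NEW, THE OPEN HEART (weaker than δ-T3 and than α-F2; implied by the KNSS Liouville conjecture, §2c).
T0 `EfficientTimesNoDust` is a THEOREM (δ §1c, copied in §1c here).  Composition
`NearExtremalTransiencePerFlow_of (hF1) (hT1) (hT2) (hG) (hH) : NearExtremalTransiencePerFlow` (no `sorry`; the extremal branch is closed
by the landed `extendedSharp` / `ext_interior_contact_nonempty_of_extremal` / `plateauSliceRigidity` exactly as in δ).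
rev 5 (§2e/§3b, ALL-TIME VARIANT, three further `sorry`s, two of them provable): T2′ `stub_zoomPackageFlow` (flow-level KNSS
convergence at every rescaled time + the pinning limit), G′ `stub_growthTransferFlow` (F1 ⇒ growth of `W τ` at EVERY `τ < 0`, Fatou per
`τ`), H′ `stub_noFilamentTubeSliceAllTime` (the heart with growth at all times in the hypothesis; `H → H′` kernel-checked; its
`x₃`-periodic sub-case is RUNG R1 of §2d), and the composition `NearExtremalTransiencePerFlow_of_allTime (hF1) (hT1) (hT2′) (hG′) (hH′)`.
Sorry count of the file: 3 (since rev 14) = T1, H (canonical path), H′ (all-time path); by kernel the crux is `⇐ T1 ∧ H` and `⇐ T1 ∧ H′` (F1, T2, G, T2′, G′ theorems of the tree).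
rev 6 (§2f): RUNG R2 `BreathingPeriodicLiouville` (growth-free, provable now: forward Oseen-mild uniqueness + line-invariant Liouville ⇒ a
Type-I ancient field `x₃`-periodic at every time with a continuous injective period law is `≡ 0`; kernel-checked corollary to H′) and
THE NECKLACE BRIEF (free parameters of a would-be counterexample to H′, critic ASK (ii)); no new `sorry`.
rev 16: R8 `ScrewSymmetricLiouville` UNCONDITIONAL by name (`screwSymmetricLiouville_holds` := ns-net-p2's landed `Theorems.ScrewSymmetricLiouville.screwSymmetricLiouville`); every symmetric necklace rung R1–R5′, R7, R8 is now a theorem; sorries 3 unchanged (T1 abstract, H, H′). rev 15 (critic's price P1 PAID): T1 re-typed to consume the zoom structure — `CoherentSelectionZoom` (= `CoherentSelection` restricted to ZOOM-COMPACT families, a free weakening: `coherentSelectionZoom_of`), both compositions consume it (`NearExtremalTransiencePerFlow_of_zoom`, `NearExtremalTransiencePerFlow_of_allTime_zoom`, std axioms), the registered-shape compositions are one-line corollaries; residual by kernel ⟨26567⟩ ⇐ T1_zoom ∧ H′ (and ⇐ T1_zoom ∧ H with T2, G); the abstract `CoherentSelection` stays as the stronger, author-doubted statement (local super-efficiency wall;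 a disprover target); sorries 3 unchanged. rev 14: T2′ `stub_zoomPackageFlow` and G′ `stub_growthTransferFlow` DISCHARGED BY NAME (ns-net-p2 g6: p688614 `zoomPackageFlow`, p687268 `growthTransferFlow`); sorries 3 = T1 `stub_coherentSelection`, H `stub_noFilamentTubeSlice`, H′ `stub_noFilamentTubeSliceAllTime`; BY KERNEL ⟨26567⟩ ⇐ T1 ∧ H′ with every other input a theorem (the tree's own composition p689218 `nearExtremalTransiencePerFlow_of_coherentSelection_of_noFilamentTubeSliceAllTime` says the same). rev 13 (§2h″): RUNG R7 `sliceGermRigidity_holds` «ONE CELL DETERMINES THE NECKLACE» (two Type-I ancient mild fields whose slices agree on one open patch at one time are equal at all negative times: slice analyticity + `oseenMild_bounded_unique` on `(s, t/2) × ℝ³` + A) and ETERNAL SYMMETRY `isometryInvariant_allTime_of_local` (a symmetry under an affine isometry seen locally on one slice holds globally at all times; class covariances `IsTypeIAncientMild.comp_add_right`, `stub_rotationCovariance` from the tree), with instances R3″ `noLocalRepetition_anyDirection` (via the tree's PROVED any-direction periodic Liouville `SymmetryModuliCountSymmetricLiouville.periodicTypeIAncientLiouville`), R5′ `isAxisymmetric_allTime_of_local`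 / `axisymmetricTubeLiouville_of_local`, and R8-fin `screwSymmetricLiouville_finiteOrder` (rational-twist necklaces dead); R8 `ScrewSymmetricLiouville` (irrational twist) filed as an OPEN rung; all UNCONDITIONAL, std axioms; sorries still 5. rev 12 (§2h′): TWO MORE UNCONDITIONAL RUNGS from slice analyticity + forward uniqueness + A — R4′ `noSliceVacuumPocket_holds` (ONE slice vanishing on an open patch ⇒ `W ≡ 0`; strictly stronger than R4) and R3′ `noLocalRepetition_holds` (ONE slice agreeing with its own `ℓe₃`-translate on an open patch ⇒ exactly periodic ⇒ `W ≡ 0` by R3): in the selected tube slice of a counterexample to H′ the cells are never vacuum-separated and no two are exact axial translates of each other even locally (`isTubeSlice_no_open_zero_set`, `isTubeSlice_no_local_repetition`); sorries still 5. rev 11 (§2g′): THE PERIODIC FAMILY IS CLOSED — A `typeIAncientMildTimeAnalytic_holds` PROVED by name (tree `analyticOnNhd_uncurry_of_oseenMild`, joint space–time analyticity of Oseen-mild Type-I ancient fields), R1′ `periodicTypeILiouville_holds` PROVED by name (p688344/p689280 `eq_zero_of_isX3Periodic`, ns-net-p1 g4), hence R3 `periodicSliceLiouville_holds`, R2 `breathingPeriodicLiouville_holds`,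 R1 `rung_R1`, R4 `noVacuumPocket_holds` are UNCONDITIONAL THEOREMS and the corollaries `noFilamentTubeSliceAllTime_periodicSlice` / `_breathing` / `_axisymmetric` settle those sub-cases of H′ outright; sorries still 5 = T1, H, T2′, G′, H′. rev 10 (§2i): RUNG R5 `AxisymmetricTubeLiouville` PROVED by name (KNSS Thm 5.3 `knss_bound_C_over_r_holds` on time-shifts): axisymmetric necklaces with `r‖W‖ ≤ C` are dead. rev 9 (§2h): RUNG R4 `NoVacuumPocket` ⇐ A (kernel-checked `noVacuumPocket_of_timeAnalytic`, identity theorem in time then space via tree `analyticOnNhd_slice_univ`): no surgery-built (vacuum-separated) necklace is an exact solution. rev 8: P `ForwardPeriodicity` PROVED by name (`forwardPeriodicity_holds` := tree `IsTypeIAncientMild.comp_add_eq_after`); A `TypeIAncientMildTimeAnalytic` is tree-provable (template `IsTypeIAncientMild.analyticOnNhd_slice_univ` + PROVED `lemarieRieusset2016_local_analyticity_holds`); hence R3 ⇐ A ∧ R1′ (`periodicSliceLiouville_of_timeAnalytic`). rev 7 (§2g): RUNG R3 `PeriodicSliceLiouville` «one exactly periodic slice kills» ⇐ P `ForwardPeriodicity`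 (provable) ∧ A
`TypeIAncientMildTimeAnalytic` (Dong–Zhang 2020 Thm 2, Literature fact to land) ∧ R1′ `PeriodicTypeILiouville` (being landed), kernel-checked
`periodicSliceLiouville_of`; corollary: the selected slice of a counterexample to H′ is never exactly periodic; no new `sorry`.

## Why it might fail · cheapest falsifier · barriers · disproof used
H fails iff some Type-I ancient mild field has a linear-growth tube slice — an ancient NECKLACE.  Cheapest falsifier: the chain
instrument kit j321232 (pre-registered in `Lines/filament_gap.md` §Instrument): NO-CHAIN-GAP (periodic chains reach the 3D plateau
`≈ 0.125`) means static near-extremal necklaces exist, so H genuinely needs the dynamics (it is then «T3 restricted to filaments», still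
open, still weaker than T3); CHAIN-GAP means α's F2 is the shorter road and H holds for the cheap reason.  A dynamic falsifier would be a
Type-I ancient necklace — none is known (KNSS 2009 Thms 1.1–1.3 exclude 2D, axisymmetric-no-swirl and small bounded ancient mild
solutions; the bounded-ancient Liouville conjecture says none exists).  Barriers: same placement as δ-T3 — implied by the KNSS Liouville
conjecture (§2c), not a Type-II statement, not an ε-regularity / CKN-dimension statement (those are rate-free and allow shrinking
necklaces), and outside the copy-invariance family E0/E1 of the route's Disproof record (one limit object with a UNIFORM growth constant,
not a local or counting statement about near-extremal slices).  Disproof used: every `_false_without_` obstruction in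
`Cruxes/NearExtremalTransiencePerFlow/Disproof.lean` drops the Type-I RATE or the EFFICIENCY clause; this line uses the rate three times
(F1, T0's scale lock, T2's Type-I inheritance) and efficiency in T0/T1.
-/

open scoped Topology InnerProductSpace RealInnerProductSpace ENNReal ContDiff
open MeasureTheory Filter Set Metric
open Literature.Analysis.FluidPDE
open Summit.NavierStokesRegularity.NavierStokesRegularity.Theses.ExtremiserTransience
open Summit.NavierStokesRegularity.NavierStokesRegularity.Theorems
open Summit.NavierStokesRegularity.NavierStokesRegularity.Theorems.ExtremiserLiouville
open Summit.NavierStokesRegularity.NavierStokesRegularity.Theorems.DepletionLadder.KStar.HalfSpace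

namespace Summit.NavierStokesRegularity.NavierStokesRegularity.Cruxes.NearExtremalTransiencePerFlow.FilamentSelection

set_option linter.dupNamespace false

/-! # Part A — vocabulary and statements COPIED VERBATIM from `Lines/member_selection.lean` (g7-δ) §0–§1 and its T0 proof §1c
(crux workfiles are not importable; identical text = identical normalised signatures). -/


/-! ## §0 Vocabulary -/

/-- The per-flow CONCLUSION of the crux for the flow `u` on `[0,T)` (verbatim). -/
def PFC (T : ℝ) (u : ℝ → EuclideanSpace ℝ (Fin 3) → EuclideanSpace ℝ (Fin 3)) : Prop :=
  ∃ θ : ℝ, 0 ≤ θ ∧ θ < 1 ∧ ∀ κ : ℝ, (∀ (v : EuclideanSpace ℝ (Fin 3) → EuclideanSpace ℝ (Fin 3)) (M B : ℝ), ContDiff ℝ (⊤ : ℕ∞) v → Literature.Analysis.FluidPDE.VectorCalculus.IsDivFree v → (∀ x, ‖v x‖ ≤ M) → (∀ x, ‖fderiv ℝ v x‖ ≤ B) → (∫⁻ x, ‖iteratedFDeriv ℝ 0 v x‖ₑ ^ 2 < ⊤) → (∫⁻ x, ‖iteratedFDeriv ℝ 1 v x‖ₑ ^ 2 < ⊤)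 → (∫⁻ x, ‖iteratedFDeriv ℝ 2 v x‖ₑ ^ 2 < ⊤) → |∫ x, ⟪Literature.Analysis.FluidPDE.curl v x, fderiv ℝ v x (Literature.Analysis.FluidPDE.curl v x)⟫_ℝ| ≤ κ * M * Real.sqrt (∫ x, ‖Literature.Analysis.FluidPDE.curl v x‖ ^ 2) * Real.sqrt (∫ x, Literature.Analysis.FluidPDE.frobeniusNormSq (fderiv ℝ (Literature.Analysis.FluidPDE.curl v) x))) → ∃ t₁ ∈ Set.Ico 0 T, ∃ (k : ℝ → ℝ) (B : ℝ), Measurable k ∧ (∀ τ, 0 ≤ k τ ∧ k τ ≤ 1) ∧ (∀ t ∈ Set.Ico t₁ T, ∀ M : ℝ, (∀ x, ‖u t x‖ ≤ M) → |∫ x, ⟪Literature.Analysis.FluidPDE.curl (u t) x, fderiv ℝ (u t) x (Literature.Analysis.FluidPDE.curl (u t) x)⟫_ℝ| ≤ k t * M * Real.sqrt (∫ x, ‖Literature.Analysis.FluidPDE.curl (u t) x‖ ^ 2) * Real.sqrt (∫ x, Literature.Analysis.FluidPDE.frobeniusNormSq (fderiv ℝ (Literature.Analysis.FluidPDE.curl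 (u t)) x))) ∧ (∀ t ∈ Set.Ico t₁ T, ∫ τ in t₁..t, k τ ^ 2 / (T - τ) ≤ (θ * κ) ^ 2 * Real.log ((T - t₁) / (T - t)) + B)

/-- The VIOLATOR FRAME (contrapositive of the crux): a flow satisfying every hypothesis of `NearExtremalTransiencePerFlow`
whose per-flow conclusion fails. -/
def IsViolator (C ν T : ℝ) (u : ℝ → EuclideanSpace ℝ (Fin 3) → EuclideanSpace ℝ (Fin 3))
    (p : ℝ → EuclideanSpace ℝ (Fin 3) → ℝ) : Prop :=
  0 < C ∧ 0 < ν ∧ 0 < T ∧ IsClassicalNSSolutionOn (Set.Ico 0 T) ν 0 u p ∧ IsLerayHopfOn T ν 0 (u 0) u ∧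
    HasRapidSpatialDecay (u 0) ∧ (∀ᶠ t in 𝓝[<] T, ∀ x, Real.sqrt (T - t) * ‖u t x‖ ≤ C * Real.sqrt ν) ∧
    ¬ HasSmoothExtensionPast ν 0 u T ∧ ¬ PFC T u

/-- EFFICIENT-TIMES DATA WITH A TAYLOR BOUND for the flow `u` (viscosity `ν`, singular time `T`): late times `t n → T`,
height bounds `Mb n ≥ ‖u (t n)‖_∞`, efficiency deficits `ε n → 0` (`(κ⋆ - ε n)·Mb n·√Z·√P ≤ |J(u (t n))|`, which pins `Mb n`
to the true height up to the factor `κ⋆/(κ⋆-ε n)`), non-trivial budgets, and the TAYLOR BOUND `Z(t n) ≤ Θ·ν(T - t n)·P(t n)`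
(dissipation length `λ² = Z/P` at most parabolic — «no dust»). -/
def EfficientTimesData (ν T : ℝ) (u : ℝ → EuclideanSpace ℝ (Fin 3) → EuclideanSpace ℝ (Fin 3))
    (Θ : ℝ) (t Mb ε : ℕ → ℝ) : Prop :=
  (∀ n, t n ∈ Set.Ico 0 T) ∧ Tendsto t atTop (𝓝 T) ∧ Tendsto ε atTop (𝓝 0) ∧ (∀ n, 0 < Mb n) ∧
    (∀ n x, ‖u (t n) x‖ ≤ Mb n) ∧
    (∀ n, 0 < Real.sqrt (∫ x, ‖curl (u (t n)) x‖ ^ 2) * Real.sqrt (∫ x, frobeniusNormSq (fderiv ℝ (curl (u (t n))) x))) ∧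
    (∀ n, (kStar - ε n) * Mb n * Real.sqrt (∫ x, ‖curl (u (t n)) x‖ ^ 2) *
        Real.sqrt (∫ x, frobeniusNormSq (fderiv ℝ (curl (u (t n))) x)) ≤
      |∫ x, ⟪curl (u (t n)) x, fderiv ℝ (u (t n)) x (curl (u (t n)) x)⟫_ℝ|) ∧
    (∀ n, (∫ x, ‖curl (u (t n)) x‖ ^ 2) ≤ Θ * (ν * (T - t n)) * ∫ x, frobeniusNormSq (fderiv ℝ (curl (u (t n))) x))

/-- A NEAR-EXTREMAL FAMILY of height-`1` slices: smooth, divergence-free, `‖v n‖ ≤ 1`, ALL derivatives bounded uniformly in `n`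
(`Λ k` for order `k`), finite `Ḣ¹, Ḣ²` budgets, non-trivial, efficiency deficit `ε n → 0` at height `1`, and the Taylor bound
`Z ≤ Θ P`.  (Exactly what the NS-compatible blow-up zoom of a Type-I violator delivers at the times of `EfficientTimesData`, T2.) -/
def NearExtremalFamily (v : ℕ → EuclideanSpace ℝ (Fin 3) → EuclideanSpace ℝ (Fin 3)) (Λ : ℕ → ℝ) (Θ : ℝ) (ε : ℕ → ℝ) : Prop :=
  (∀ n, ContDiff ℝ (⊤ : ℕ∞) (v n)) ∧ (∀ n, Literature.Analysis.FluidPDE.VectorCalculus.IsDivFree (v n)) ∧ (∀ n x, ‖v n x‖ ≤ 1) ∧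
    (∀ (k : ℕ) n x, ‖iteratedFDeriv ℝ k (v n) x‖ ≤ Λ k) ∧
    (∀ n, (∫⁻ x, ‖iteratedFDeriv ℝ 1 (v n) x‖ₑ ^ 2 < ⊤) ∧ (∫⁻ x, ‖iteratedFDeriv ℝ 2 (v n) x‖ₑ ^ 2 < ⊤)) ∧
    Tendsto ε atTop (𝓝 0) ∧
    (∀ n, 0 < Real.sqrt (∫ x, ‖curl (v n) x‖ ^ 2) * Real.sqrt (∫ x, frobeniusNormSq (fderiv ℝ (curl (v n)) x))) ∧
    (∀ n, (kStar - ε n) * Real.sqrt (∫ x, ‖curl (v n) x‖ ^ 2) * Real.sqrt (∫ x, frobeniusNormSq (fderiv ℝ (curl (v n)) x)) ≤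
      |∫ x, ⟪curl (v n) x, fderiv ℝ (v n) x (curl (v n) x)⟫_ℝ|) ∧
    (∀ n, (∫ x, ‖curl (v n) x‖ ^ 2) ≤ Θ * ∫ x, frobeniusNormSq (fderiv ℝ (curl (v n)) x))

/-- An EXACTLY EXTREMAL EXTENDED SLICE (verbatim slice clause of items 26569/27696 with `W t ↦ w`): smooth, divergence-free,
bounded gradient, `D¹w, D²w ∈ L²`, and a height bound `M` with `0 < M√Z√P` at which `κ⋆·M·√Z·√P ≤ |J(w)|`. -/
def IsExtremalSlice (w : EuclideanSpace ℝ (Fin 3) → EuclideanSpace ℝ (Fin 3)) : Prop :=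
  (ContDiff ℝ (⊤ : ℕ∞) w ∧ Literature.Analysis.FluidPDE.VectorCalculus.IsDivFree w ∧ (∃ B : ℝ, ∀ x, ‖fderiv ℝ w x‖ ≤ B) ∧ (∫⁻ x, ‖iteratedFDeriv ℝ 1 w x‖ₑ ^ 2 < ⊤) ∧ (∫⁻ x, ‖iteratedFDeriv ℝ 2 w x‖ₑ ^ 2 < ⊤) ∧ ∃ M : ℝ, (∀ x, ‖w x‖ ≤ M) ∧ 0 < M * Real.sqrt (∫ x, ‖Literature.Analysis.FluidPDE.curl w x‖ ^ 2) * Real.sqrt (∫ x, Literature.Analysis.FluidPDE.frobeniusNormSq (fderiv ℝ (Literature.Analysis.FluidPDE.curl w) x)) ∧ (sInf {κ : ℝ | (∀ (v : EuclideanSpace ℝ (Fin 3) → EuclideanSpace ℝ (Fin 3)) (M B : ℝ), ContDiff ℝ (⊤ : ℕ∞) v → Literature.Analysis.FluidPDE.VectorCalculus.IsDivFree v → (∀ x, ‖v x‖ ≤ M) → (∀ x, ‖fderiv ℝ v x‖ ≤ B) → (∫⁻ x, ‖iteratedFDeriv ℝ 0 v x‖ₑ ^ 2 < ⊤) → (∫⁻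 x, ‖iteratedFDeriv ℝ 1 v x‖ₑ ^ 2 < ⊤) → (∫⁻ x, ‖iteratedFDeriv ℝ 2 v x‖ₑ ^ 2 < ⊤) → |∫ x, ⟪Literature.Analysis.FluidPDE.curl v x, fderiv ℝ v x (Literature.Analysis.FluidPDE.curl v x)⟫_ℝ| ≤ κ * M * Real.sqrt (∫ x, ‖Literature.Analysis.FluidPDE.curl v x‖ ^ 2) * Real.sqrt (∫ x, Literature.Analysis.FluidPDE.frobeniusNormSq (fderiv ℝ (Literature.Analysis.FluidPDE.curl v) x)))}) * M * Real.sqrt (∫ x, ‖Literature.Analysis.FluidPDE.curl w x‖ ^ 2) * Real.sqrt (∫ x, Literature.Analysis.FluidPDE.frobeniusNormSq (fderiv ℝ (Literature.Analysis.FluidPDE.curl w) x)) ≤ |∫ x, ⟪Literature.Analysis.FluidPDE.curl w x, fderiv ℝ w x (Literature.Analysis.FluidPDE.curl w x)⟫_ℝ|)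

/-- A TUBE SLICE: smooth, divergence-free, bounded gradient, height bound `M`, INFINITE budget (`D¹w` or `D²w` not in `L²`), and
asymptotically `κ⋆`-efficient at height `M` along an exhaustion by bounded measurable sets `D k ⊇ B(0, ρ k)`, `ρ k → ∞`, with
deficits `δ k → 0` (plain restricted integrals — no cut-off correction).  The single-slice, exhaustion form of item 27695's sheet. -/
def IsTubeSlice (w : EuclideanSpace ℝ (Fin 3) → EuclideanSpace ℝ (Fin 3)) : Prop :=
  ContDiff ℝ (⊤ : ℕ∞) w ∧ Literature.Analysis.FluidPDE.VectorCalculus.IsDivFree w ∧ (∃ B : ℝ, ∀ x, ‖fderiv ℝ w x‖ ≤ B) ∧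
    ¬ ((∫⁻ x, ‖iteratedFDeriv ℝ 1 w x‖ₑ ^ 2 < ⊤) ∧ (∫⁻ x, ‖iteratedFDeriv ℝ 2 w x‖ₑ ^ 2 < ⊤)) ∧
    ∃ (M : ℝ) (D : ℕ → Set (EuclideanSpace ℝ (Fin 3))) (ρ δ : ℕ → ℝ), (∀ x, ‖w x‖ ≤ M) ∧
      Tendsto ρ atTop atTop ∧ Tendsto δ atTop (𝓝 0) ∧
      ∀ k, MeasurableSet (D k) ∧ Metric.ball 0 (ρ k) ⊆ D k ∧ Bornology.IsBounded (D k) ∧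
        (kStar - δ k) * M * Real.sqrt (∫ x in D k, ‖curl w x‖ ^ 2) * Real.sqrt (∫ x in D k, frobeniusNormSq (fderiv ℝ (curl w) x)) ≤
          |∫ x in D k, ⟪curl w x, fderiv ℝ w x (curl w x)⟫_ℝ|

/-- ZOOM COMPACTNESS of a family of slices: along ANY centres `y n` and ANY subsequence `φ`, a further subsequence of the translates
`v (φ (ψ n)) (y (φ (ψ n)) + ·)` converges pointwise to a slice `W s`, `s < 0`, of a Type-I ANCIENT MILD field
(`IsTypeIAncientMild K W`: smooth on `(-∞,0) × ℝ³`, divergence-free, Oseen-mild between all `s < t < 0`, `‖W t‖_∞ ≤ K/√(-t)`). -/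
def ZoomCompact (v : ℕ → EuclideanSpace ℝ (Fin 3) → EuclideanSpace ℝ (Fin 3)) : Prop :=
  ∀ (y : ℕ → EuclideanSpace ℝ (Fin 3)) (φ : ℕ → ℕ), StrictMono φ →
    ∃ (ψ : ℕ → ℕ) (K s : ℝ) (W : ℝ → EuclideanSpace ℝ (Fin 3) → EuclideanSpace ℝ (Fin 3)), StrictMono ψ ∧
      Literature.Analysis.FluidPDE.IsTypeIAncientMild K W ∧ s < 0 ∧
      ∀ z, Tendsto (fun n => v (φ (ψ n)) (y (φ (ψ n)) + z)) atTop (𝓝 (W s z))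

/-! ## §1 The four statements of the line -/

/-- (T0 — PROVED in §1c, the sequential «no dust» form of the upper scale lock) EFFICIENT TIMES WITH A TAYLOR BOUND: a violator
flow has a sequence of late times `t n → T` that are near-efficient (deficit `→ 0`) AND carry the Taylor bound `Z ≤ Θ·ν(T-t)·P`
(dissipation length at most parabolic).  Both halves at once are the landed `PerFlow.upperLock_at_nearEfficient_times` (g4-α:
`lockedTimes_logDensity` + `efficientTimes_logDensity_of_not_perFlow`); the opposite half `Z/P ≳ ν(T-t)` at near-efficient times is
the landed `PerFlow.lowerLock_at_nearEfficient_times` (not needed here). -/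
def EfficientTimesNoDust : Prop :=
  ∀ (C ν T : ℝ) (u : ℝ → EuclideanSpace ℝ (Fin 3) → EuclideanSpace ℝ (Fin 3)) (p : ℝ → EuclideanSpace ℝ (Fin 3) → ℝ),
    IsViolator C ν T u p → ∃ (Θ : ℝ) (t Mb ε : ℕ → ℝ), EfficientTimesData ν T u Θ t Mb ε

/-- (T1 — the NEW LEVER, slice-level pure analysis) COHERENT SELECTION: a near-extremal height-`1` family with a Taylor bound has
centres, a subsequence and a pointwise limit of translates which is an exactly extremal extended slice (finite budget) or a tube
slice (infinite budget).  Mechanism: cell-wise Cauchy–Schwarz at global height; share of a cell of Taylor scale `L` is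
`≤ √(Z/P)/L ≤ √Θ/L`; nested selection; `C^∞_loc` compactness from the uniform bounds; `extendedSharp` closes the finite case. -/
def CoherentSelection : Prop :=
  ∀ (v : ℕ → EuclideanSpace ℝ (Fin 3) → EuclideanSpace ℝ (Fin 3)) (Λ : ℕ → ℝ) (Θ : ℝ) (ε : ℕ → ℝ),
    NearExtremalFamily v Λ Θ ε →
      ∃ (y : ℕ → EuclideanSpace ℝ (Fin 3)) (φ : ℕ → ℕ) (W₀ : EuclideanSpace ℝ (Fin 3) → EuclideanSpace ℝ (Fin 3)),
        StrictMono φ ∧ (∀ z, Tendsto (fun n => v (φ n) (y (φ n) + z)) atTop (𝓝 (W₀ z))) ∧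
        (IsExtremalSlice W₀ ∨ IsTubeSlice W₀)

/-- (T1_zoom — rev 15, critic's price P1, a FREE WEAKENING) COHERENT SELECTION FOR ZOOM-COMPACT FAMILIES: the conclusion of
`CoherentSelection`, asked only of near-extremal height-`1` families that are ZOOM-COMPACT (`ZoomCompact`: along any centres and any
subsequence a further subsequence of the translates converges pointwise to a slice `W s`, `s < 0`, of a Type-I ancient mild field) —
the ONLY families the compositions below apply T1 to (the NS-compatible zooms of a violator flow, T2/T2′).  Weaker than
`CoherentSelection` (`coherentSelectionZoom_of`); its proof may use the NS structure of every translate limit (time analyticity A,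
R3′/R4′/R7 of this file, KNSS) — the room the multi-scale «density-one / no-dust» input of the front end needs (ns-net-p1 census
2026-08-29; the abstract statement meets the local super-efficiency wall: restricted-integral efficiency `J_Q/√(Z_Q P_Q)` is unbounded
above, e.g. `v = ½ω̄×x + Sx` on a collared cube has `P = 0`, `J ≠ 0`).  The abstract `CoherentSelection` stays as the STRONGER,
author-doubted statement (a disprover target); the line's residual by kernel is `⟨26567⟩ ⇐ T1_zoom ∧ H′`
(`NearExtremalTransiencePerFlow_of_allTime_zoom`). [folklore framing; no summit is proved by a line] -/
def CoherentSelectionZoom : Prop :=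
  ∀ (v : ℕ → EuclideanSpace ℝ (Fin 3) → EuclideanSpace ℝ (Fin 3)) (Λ : ℕ → ℝ) (Θ : ℝ) (ε : ℕ → ℝ),
    NearExtremalFamily v Λ Θ ε → ZoomCompact v →
      ∃ (y : ℕ → EuclideanSpace ℝ (Fin 3)) (φ : ℕ → ℕ) (W₀ : EuclideanSpace ℝ (Fin 3) → EuclideanSpace ℝ (Fin 3)),
        StrictMono φ ∧ (∀ z, Tendsto (fun n => v (φ n) (y (φ n) + z)) atTop (𝓝 (W₀ z))) ∧
        (IsExtremalSlice W₀ ∨ IsTubeSlice W₀)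

/-- `CoherentSelection → CoherentSelectionZoom` (drop the compactness hypothesis). -/
theorem coherentSelectionZoom_of (h : CoherentSelection) : CoherentSelectionZoom :=
  fun v Λ Θ ε hfam _ => h v Λ Θ ε hfam

/-- (T2 — glue on landed KNSS compactness, parabolic regularity and Type-I inheritance) ZOOM PACKAGE: for a violator flow with
efficient-times data, the NS-COMPATIBLE zoomed slices `v n y := (Mb n)⁻¹ • u (t n) ((ν / Mb n) • y)` (height `1`, length `ν/Mb n`,
so that `(s,y) ↦ (Mb n)⁻¹ u(t n + (ν/(Mb n)²) s, (ν/Mb n) y)` is a unit-viscosity solution with `v n` as its time-`0` slice and blow-up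
at `s = (Mb n)² (T - t n)/ν ∈ [c₀², C²(1+o(1))]`) form, along a subsequence `σ` (late times: the zoomed solution exists on `s ∈ [-1,0]` and `(Mb n)²(T-t n)/ν` converges), a
near-extremal family (efficiency is invariant under the zoom; `Z ≤ Θ' P` with `Θ' = Θ·sup (Mb n)²(T-t n)/ν`) and are zoom-compact (KNSS 2009 Prop. 4.1 / Lemma 6.1, landed as
`Literature.Analysis.FluidPDE.KNSS2009_lemma61_ancientMild_of_oseenMild`, `isKNSSBlowupLimit_of_oseenMild_zoom_nearVertex`; Leray's
lower rate `lerayLowerRate_of_not_extends` keeps the vertex at `s* < 0`). -/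
def ZoomPackage : Prop :=
  ∀ (C ν T : ℝ) (u : ℝ → EuclideanSpace ℝ (Fin 3) → EuclideanSpace ℝ (Fin 3)) (p : ℝ → EuclideanSpace ℝ (Fin 3) → ℝ),
    IsViolator C ν T u p → ∀ (Θ : ℝ) (t Mb ε : ℕ → ℝ), EfficientTimesData ν T u Θ t Mb ε →
      ∃ (σ : ℕ → ℕ) (Λ : ℕ → ℝ) (Θ' : ℝ) (ε' : ℕ → ℝ), StrictMono σ ∧
        NearExtremalFamily (fun n y => (Mb (σ n))⁻¹ • u (t (σ n)) ((ν / Mb (σ n)) • y)) Λ Θ' ε' ∧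
        ZoomCompact (fun n y => (Mb (σ n))⁻¹ • u (t (σ n)) ((ν / Mb (σ n)) • y))

/-- (T3 — OPEN HEART #2) NO TUBE SLICE: no slice of a Type-I ancient mild field is a tube slice (infinite budget, asymptotically
`κ⋆`-efficient along an exhaustion).  The single-slice form of item 27695 `NoQuantumSheet`; implied by the KNSS Type-I Liouville
conjecture (`W ≡ 0`); constants, 2D and axisymmetric-no-swirl Type-I ancient fields are excluded by KNSS 2009 Thms 1.1–1.3. -/
def NoTubeSlice : Prop :=
  ∀ (K : ℝ) (W : ℝ → EuclideanSpace ℝ (Fin 3) → EuclideanSpace ℝ (Fin 3)) (s : ℝ),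
    Literature.Analysis.FluidPDE.IsTypeIAncientMild K W → s < 0 → ¬ IsTubeSlice (W s)

/-! ## §1c T0 is a THEOREM: efficient late times WITH the Taylor bound (landed `PerFlow.upperLock_at_nearEfficient_times`) -/

/-- **T0 PROVED.**  A violator flow has efficient-times data with a Taylor bound: for every `n`, the landed
`DepletionLadder.PerFlow.upperLock_at_nearEfficient_times` (g4-α: locked times have positive lower log-density, efficient times have
full upper log-density) gives, past the onset `T - T/(n+1)`, a time at which the flow is strictly `κ⋆(1 - 1/(n+2))`-efficient at some
height bound `M` AND `Z ≤ c₂·ν(T-t)·P`; positivity of `M` and of the budgets follows from the flow-wise sharp inequality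
(`flowwise_of_universal sharpDepletion_is_universal`). -/
theorem efficientTimesNoDust_holds : EfficientTimesNoDust := by
  intro C ν T u p hV
  obtain ⟨hC, hν, hT, hsol, hLH, hdec, hrate, hext, hnot⟩ := hV
  obtain ⟨c₂, hc₂⟩ := DepletionLadder.PerFlow.upperLock_at_nearEfficient_times hC hν hT hsol hLH hdec hrate hext hnot
  have hK : 0 < kStar := kStar_pos
  have hfw := DepletionLadder.flowwise_of_universal DepletionLadder.sharpDepletion_is_universal hν hT hsol hLH hdec
  -- one efficient, Taylor-bounded time past each onset `T - T/(n+1)`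
  have key : ∀ n : ℕ, ∃ t : ℝ, t ∈ Set.Ico (T - T / ((n : ℝ) + 1)) T ∧ t ∈ Set.Ico 0 T ∧ ∃ M : ℝ, (∀ x, ‖u t x‖ ≤ M) ∧
      (kStar - kStar / ((n : ℝ) + 2)) * M * Real.sqrt (∫ x, ‖curl (u t) x‖ ^ 2) *
          Real.sqrt (∫ x, frobeniusNormSq (fderiv ℝ (curl (u t)) x)) <
        |∫ x, ⟪curl (u t) x, fderiv ℝ (u t) x (curl (u t) x)⟫_ℝ| ∧
      (∫ x, ‖curl (u t) x‖ ^ 2) ≤ c₂ * (ν * (T - t)) * ∫ x, frobeniusNormSq (fderiv ℝ (curl (u t)) x) := by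
    intro n
    have hn1 : (0 : ℝ) < (n : ℝ) + 1 := by positivity
    have hn2 : (0 : ℝ) < (n : ℝ) + 2 := by positivity
    have hm : 0 < kStar - kStar / ((n : ℝ) + 2) := by
      rw [sub_pos, div_lt_iff₀ hn2]; nlinarith
    have hmlt : kStar - kStar / ((n : ℝ) + 2) < kStar := by
      have : 0 < kStar / ((n : ℝ) + 2) := div_pos hK hn2
      linarith
    have ht₁ : T - T / ((n : ℝ) + 1) ∈ Set.Ico 0 T := by
      refine ⟨?_, ?_⟩
      · rw [sub_nonneg, div_le_iff₀ hn1]; nlinarith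
      · have : 0 < T / ((n : ℝ) + 1) := div_pos hT hn1
        linarith
    have hmlt' := hmlt
    unfold kStar udcSet at hmlt'
    have hne := hc₂ _ hm hmlt' _ ht₁
    obtain ⟨t, ht⟩ := MeasureTheory.nonempty_of_measure_ne_zero hne
    simp only [Set.mem_setOf_eq] at ht
    obtain ⟨htI, ⟨M, hM, hstrict⟩, hZ⟩ := ht
    refine ⟨t, htI, ⟨le_trans ht₁.1 htI.1, htI.2⟩, M, hM, ?_, hZ⟩
    have := hstrict
    unfold kStar udcSet
    exact this
  choose t htI ht0 M hM hstrict hZ using key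
  refine ⟨c₂, t, M, fun n => kStar / ((n : ℝ) + 2), ht0, ?_, ?_, ?_, hM, ?_, ?_, ?_⟩
  · -- `t n → T`: squeezed between `T - T/(n+1)` and `T`
    have hlow : Tendsto (fun n : ℕ => T - T / ((n : ℝ) + 1)) atTop (𝓝 T) := by
      have h1 : Tendsto (fun n : ℕ => T / ((n : ℝ) + 1)) atTop (𝓝 0) :=
        tendsto_const_nhds.div_atTop (tendsto_natCast_atTop_atTop.atTop_add tendsto_const_nhds)
      simpa using tendsto_const_nhds.sub h1
    exact tendsto_of_tendsto_of_tendsto_of_le_of_le hlow tendsto_const_nhds (fun n => (htI n).1) (fun n => (htI n).2.le)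
  · -- `ε n = κ⋆/(n+2) → 0`
    exact tendsto_const_nhds.div_atTop (tendsto_natCast_atTop_atTop.atTop_add tendsto_const_nhds)
  · -- `0 < M n`: else the flow-wise sharp inequality contradicts strict efficiency
    intro n
    have hJle := hfw (t n) (ht0 n) (M n) (hM n)
    have hM0 : 0 ≤ M n := le_trans (norm_nonneg _) (hM n 0)
    by_contra hneg
    have hMz : M n = 0 := le_antisymm (not_lt.1 hneg) hM0
    have h1 := hstrict n
    rw [hMz] at h1 hJle
    simp only [mul_zero, zero_mul] at h1 hJle
    linarith
  · -- `0 < √Z·√P`: same argument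
    intro n
    have hJle := hfw (t n) (ht0 n) (M n) (hM n)
    have h1 := hstrict n
    have hnn : 0 ≤ Real.sqrt (∫ x, ‖curl (u (t n)) x‖ ^ 2) * Real.sqrt (∫ x, frobeniusNormSq (fderiv ℝ (curl (u (t n))) x)) :=
      mul_nonneg (Real.sqrt_nonneg _) (Real.sqrt_nonneg _)
    by_contra hneg
    have hz : Real.sqrt (∫ x, ‖curl (u (t n)) x‖ ^ 2) * Real.sqrt (∫ x, frobeniusNormSq (fderiv ℝ (curl (u (t n))) x)) = 0 :=
      le_antisymm (not_lt.1 hneg) hnn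
    have e1 : (kStar - kStar / ((n : ℝ) + 2)) * M n * Real.sqrt (∫ x, ‖curl (u (t n)) x‖ ^ 2) *
        Real.sqrt (∫ x, frobeniusNormSq (fderiv ℝ (curl (u (t n))) x)) = 0 := by
      rw [mul_assoc, hz, mul_zero]
    have e2 : sInf udcSet * M n * Real.sqrt (∫ x, ‖curl (u (t n)) x‖ ^ 2) *
        Real.sqrt (∫ x, frobeniusNormSq (fderiv ℝ (curl (u (t n))) x)) = 0 := by
      rw [mul_assoc, hz, mul_zero]
    unfold udcSet at e2
    linarith
  · exact fun n => (hstrict n).le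
  · exact hZ


/-! # Part B — the statement COPIED VERBATIM from `Lines/filament_gap.lean` (g9-α) §1: F1 -/

/-- (F1 — COPY of g9-α `FilamentGap.FlowFilamentBudget`; provable-grade, flow side) FILAMENT BUDGET: a classical solution on `[0,T) × ℝ³`
from rapidly decaying Leray–Hopf data with eventual Type-I rate `√(T−t)‖u(t)‖_∞ ≤ C√ν` has, for some `A` and all late `t`,
`∫_{B(x,r)}|u(t)|² ≤ A·ν²·r` for EVERY centre `x` and EVERY radius `r > 0`. -/
def FlowFilamentBudget : Prop :=
  ∀ (C ν T : ℝ), 0 < C → 0 < ν → 0 < T → ∀ (u : ℝ → E3 → E3) (p : ℝ → E3 → ℝ),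
    IsClassicalNSSolutionOn (Set.Ico 0 T) ν 0 u p → IsLerayHopfOn T ν 0 (u 0) u → HasRapidSpatialDecay (u 0) →
    (∀ᶠ t in 𝓝[<] T, ∀ x, Real.sqrt (T - t) * ‖u t x‖ ≤ C * Real.sqrt ν) →
    ∃ A : ℝ, ∀ᶠ t in 𝓝[<] T, ∀ (x : E3) (r : ℝ), 0 < r → ∫ y in Metric.ball x r, ‖u t y‖ ^ 2 ≤ A * ν ^ 2 * r

/-! # Part C — the two NEW statements of this line -/

/-- LINEAR LOCAL-ENERGY GROWTH at unit height and unit viscosity (the zoom normalisation): every ball of radius `R > 0` carries energy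
at most `A·R`.  A necklace of unit cells has it; a sheet (`≍ R²`) or a 3D crowd (`≍ R³`) does not. -/
def HasLinGrowth (A : ℝ) (w : E3 → E3) : Prop :=
  ∀ (x : E3) (R : ℝ), 0 < R → ∫ z in Metric.ball x R, ‖w z‖ ^ 2 ≤ A * R

/-- (G — glue, provable, S/M) GROWTH TRANSFER: if the slices `U n` obey the physical-units budget `∫_{B(x,r)}|U n|² ≤ A·ν²·r`
(eventually in `n`, all `x`, all `r > 0`), then every pointwise limit `W₀` of translates of the NS-compatible zooms
`z ↦ (Mb n)⁻¹ • U n ((ν / Mb n) • z)` (continuous, height ≤ 1) along a subsequence has `HasLinGrowth A W₀` with the SAME constant: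
change of variables (`r = (ν/Mb n)·R`; the factor `(Mb n)⁻² · (Mb n/ν)³ · ν² · (ν/Mb n) = 1`) and dominated convergence on each ball. -/
def GrowthTransfer : Prop :=
  ∀ (ν A : ℝ) (U : ℕ → E3 → E3) (Mb : ℕ → ℝ) (y : ℕ → E3) (φ : ℕ → ℕ) (W₀ : E3 → E3),
    0 < ν → (∀ n, 0 < Mb n) →
    (∀ n, Continuous fun z : E3 => (Mb n)⁻¹ • U n ((ν / Mb n) • z)) →
    (∀ n (z : E3), ‖(Mb n)⁻¹ • U n ((ν / Mb n) • z)‖ ≤ 1) →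
    (∀ᶠ n in atTop, ∀ (x : E3) (r : ℝ), 0 < r → ∫ z in Metric.ball x r, ‖U n z‖ ^ 2 ≤ A * ν ^ 2 * r) →
    StrictMono φ →
    (∀ z, Tendsto (fun n => (Mb (φ n))⁻¹ • U (φ n) ((ν / Mb (φ n)) • (y (φ n) + z))) atTop (𝓝 (W₀ z))) →
    HasLinGrowth A W₀

/-- (H — THE OPEN HEART) NO FILAMENT TUBE SLICE: no slice `W s` (`s < 0`) of a Type-I ancient mild field (`IsTypeIAncientMild K W`:
smooth on `(-∞,0) × ℝ³`, divergence-free, Oseen-mild, `‖W t‖_∞ ≤ K/√(-t)`) that has linear local-energy growth `∫_{B(x,R)}|W s|² ≤ A·R`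
is a tube slice (infinite `Ḣ¹/Ḣ²` budget, asymptotically `κ⋆`-efficient along an exhaustion — `IsTubeSlice`, δ's definition).
WEAKER than δ-T3 `NoTubeSlice` (growth hypothesis added) and than α-F2 `ChainGap` (dynamics added); implied by the KNSS bounded-ancient
Liouville conjecture (§2c).  Why it might fail: a Type-I ancient NECKLACE (infinite chain of `λ`-spaced near-top cells) would be a
counterexample; no such object is known or excluded (its forced features and free parameters: THE NECKLACE BRIEF, §2f; exactly periodic and
breathing-periodic necklaces are dead by RUNGS R1/R2, §2d/§2f). -/
def NoFilamentTubeSlice : Prop :=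
  ∀ (K A : ℝ) (W : ℝ → E3 → E3) (s : ℝ), IsTypeIAncientMild K W → s < 0 → HasLinGrowth A (W s) → ¬ IsTubeSlice (W s)

/-! ## §2 Stubs (the only `sorry`s of this file) -/

/-- F1 (copy of g9-α F1). -/
/- F1 is now a THEOREM of the tree (prover ns-net-p2 g5, p684070, 2026-08-29): the stub is discharged by name. -/
theorem stub_flowFilamentBudget : FlowFilamentBudget :=
  Summit.NavierStokesRegularity.NavierStokesRegularity.Theorems.NearExtremalTransiencePerFlow.FilamentGap.flowFilamentBudget

/-- T1 (copy of g7-δ T1). -/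
theorem stub_coherentSelection : CoherentSelection := by
  sorry

/-- T2 (copy of g7-δ T2). -/
/- T2 is a THEOREM of the tree (prover ns-net-p1, p665546, δ line); the verbatim copy closes by name (confirmed by ns-net-p2 g5, 2026-08-29T01:13Z). -/
theorem stub_zoomPackage : ZoomPackage :=
  Summit.NavierStokesRegularity.NavierStokesRegularity.Theorems.NearExtremalTransiencePerFlow.MemberSelection.stub_zoomPackage

/-- G (new glue). -/
/- G is now a THEOREM of the tree (prover ns-net-p2 g5, p685102, 2026-08-29T01:12Z): discharged by name. -/
theorem stub_growthTransfer : GrowthTransfer :=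
  Summit.NavierStokesRegularity.NavierStokesRegularity.Theorems.NearExtremalTransiencePerFlow.FilamentSelection.growthTransfer

/-- H (new open heart). -/
theorem stub_noFilamentTubeSlice : NoFilamentTubeSlice := by
  sorry

/-! ## §2b Registration-style block (the names the composition consumes; NOT registered — files-only seat) -/

namespace Registered

/-- stub F1 (shared with g9-α) -/
abbrev stub_flowFilamentBudget : Prop := FlowFilamentBudget
/-- stub T1 (shared with g7-δ) -/
abbrev stub_coherentSelection : Prop := CoherentSelection
/-- stub T2 (shared with g7-δ) -/
abbrev stub_zoomPackage : Prop := ZoomPackage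
/-- stub G -/
abbrev stub_growthTransfer : Prop := GrowthTransfer
/-- stub H -/
abbrev stub_noFilamentTubeSlice : Prop := NoFilamentTubeSlice

end Registered

theorem stub_flowFilamentBudget_holds : Registered.stub_flowFilamentBudget := stub_flowFilamentBudget
theorem stub_coherentSelection_holds : Registered.stub_coherentSelection := stub_coherentSelection
theorem stub_zoomPackage_holds : Registered.stub_zoomPackage := stub_zoomPackage
theorem stub_growthTransfer_holds : Registered.stub_growthTransfer := stub_growthTransfer
theorem stub_noFilamentTubeSlice_holds : Registered.stub_noFilamentTubeSlice := stub_noFilamentTubeSlice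

/-! ## §2c Placement (kernel-checked, no `sorry`): H is below δ-T3, hence below the KNSS Liouville conjecture -/

/-- `NoTubeSlice → NoFilamentTubeSlice` (drop the growth hypothesis). -/
theorem noFilamentTubeSlice_of_noTubeSlice (h : NoTubeSlice) : NoFilamentTubeSlice :=
  fun K _A W s hW hs _hg => h K W s hW hs

/-- H follows from the canonical KNSS Liouville conjecture `LiouvilleConjectureNS` (bounded ancient mild ⇒ slices a.e. constant):
δ's argument (`member_selection.lean` §3b) verbatim for T3, then drop the growth hypothesis. -/
theorem noFilamentTubeSlice_of_liouvilleConjectureNS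
    (hL : Summit.NavierStokesRegularity.NavierStokesRegularity.LiouvilleConjectureNS) : NoFilamentTubeSlice := by
  refine noFilamentTubeSlice_of_noTubeSlice ?_
  intro K W s hW hs htube
  have hδ : 0 < -s / 2 := by linarith
  have hB := hW.isBoundedAncientMildSolution_sub hδ
  have hmeas : ∀ t < 0, AEStronglyMeasurable ((fun t => W (t - -s / 2)) t) volume :=
    fun t ht => hW.aestronglyMeasurable_slice (by linarith)
  obtain ⟨b, hb⟩ := hL _ hB hmeas (s / 2) (by linarith)
  have e : s / 2 - -s / 2 = s := by ring
  have hb' : W s =ᵐ[volume] fun _ => b := by simpa only [e] using hb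
  have hWb : W s = fun _ => b :=
    (Continuous.ae_eq_iff_eq volume (hW.continuous_slice hs) continuous_const).1 hb'
  apply htube.2.2.2.1
  rw [hWb]
  refine ⟨?_, ?_⟩ <;> simp [iteratedFDeriv_const_of_ne]


/-! ## §2d OFFERED RUNG (rev 3; a statement for H-hands and provers, NOT a stub of this line): PERIODIC FILAMENTS ARE DEAD

The zoom delivers the filament budget at EVERY rescaled time `τ < 0`, not only at the selected slice (F1 holds at all late
physical times; the NS-compatible zoom maps `τ ↦ t_n + (ν/M_n²)(τ - s)`, late for `n ≥ n(τ)`; KNSS local-uniform convergence at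
every `τ < 0`), so H may be re-cut with the hypothesis `∀ τ < 0, HasLinGrowth A (W τ)` at no cost on the flow side.  In that form its
`x₃`-PERIODIC sub-case is a THEOREM-SIZED RUNG, by an elementary energy argument that USES the Type-I rate essentially:
(1) periodicity + linear growth ⇒ finite energy per period, `E(τ) := ∫_{ℝ²×[0,ℓ]} |W τ|² ≤ A·ℓ` for all `τ` (cover `R/ℓ - 1` periods
by `B(0,R)`, let `R → ∞`); (2) split `W = W̄ + W̃` (`x₃`-average and zero-average part; both divergence-free); the energy identity
for `W̃` on `ℝ² × (ℝ/ℓℤ)` (justified by `E < ∞`, boundedness, `p ∈ L²` via the periodic Riesz transforms) has only ONE surviving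
nonlinear term: `d/dτ ½‖W̃‖² = -‖∇W̃‖² - ∫ W̃·(W̃·∇)W̄` (the terms `∫W̃·(W·∇)W̃`, `∫W̃·(W̄·∇)W̄`, `∫W̃·∇p̃` vanish by antisymmetry
/ zero `x₃`-average); (3) Poincaré in `x₃`: `‖∇W̃‖² ≥ (2π/ℓ)²‖W̃‖²`; Type-I mild smoothing: `‖∇W(τ)‖_∞ ≤ C_K/(-τ)`
(`KNSS2009_mild_regularity_holds`, rescaled); hence `d/dτ ‖W̃‖² ≤ -2[(2π/ℓ)² - C_K/(-τ)]‖W̃‖² ≤ -(2π/ℓ)²‖W̃‖²` for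
`τ ≤ -τ_* := -2C_Kℓ²/(2π)²`; (4) `‖W̃(τ)‖² ≤ A ℓ · e^{-(2π/ℓ)²(τ-τ₀)}` for every `τ₀ < τ ≤ -τ_*`; `τ₀ → -∞` gives `W̃ ≡ 0`:
`W` is `x₃`-INDEPENDENT on `(-∞, -τ_*]`; (5) an `x₃`-independent solution is 2.5D: `W_h` is a bounded ancient solution of 2D
Navier–Stokes on `ℝ² × (-∞,-τ_*)`, hence `W_h(τ,·) = b(τ)` by the LANDED planar Liouville theorem `KNSS2009_liouville_planar_holds`
(KNSS 2009 Thm 5.1), and `W₃` then solves the heat equation with the spatially constant drift `b(τ)` (`∂₃ p = 0`), bounded and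
ancient ⇒ constant (caloric Liouville); Type-I decay `‖W(τ)‖_∞ ≤ K/√(-τ) → 0` forces the constants to vanish: `W ≡ 0` on
`(-∞,-τ_*]`; (6) forward uniqueness of bounded mild solutions ⇒ `W ≡ 0` for all `τ < 0`.  WITHOUT the Type-I rate step (3) fails
(`‖∇W‖_∞ = O(1)` need not be beaten by `(2π/ℓ)²`); without linear growth step (1) fails (KNSS-class solutions have infinite energy
per period) — the rung exercises exactly the two inputs of this line.  The general (aperiodic) necklace is the crux: its natural
`x₃`-wavelength `≍ √(-τ)` is self-similar, so the Poincaré gain `≍ 1/(-τ)` and the stretching `C_K/(-τ)` are of the SAME order —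
the honest obstruction, and the reason H is open.  Nearest print result: Lei–Ren–Zhang-type Liouville for `z`-periodic
AXISYMMETRIC bounded ancient solutions (arXiv:1902.11229 Thm 1.1: no Type-I, no growth hypothesis, but axisymmetry + bounded `Γ`). -/

/-- `x₃`-periodicity with period `ℓ` (translation by `ℓ·e₃`). -/
def IsX3Periodic (ℓ : ℝ) (w : EuclideanSpace ℝ (Fin 3) → EuclideanSpace ℝ (Fin 3)) : Prop :=
  ∀ x, w (x + ℓ • EuclideanSpace.single (2 : Fin 3) (1 : ℝ)) = w x

/-- RUNG R1 «periodic filaments are dead» (OFFERED STATEMENT, provable-grade, size L; not a registered stub of this line): an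
`x₃`-periodic Type-I ancient mild field all of whose slices have linear local-energy growth with one constant is identically zero.
Inputs by name: `KNSS2009_liouville_planar_holds` (2D Liouville, landed), `KNSS2009_mild_regularity_holds` (gradient decay),
uniqueness of bounded mild solutions (tree: Oseen–mild uniqueness used by route `SymmetryModuliCount`), a caloric Liouville lemma. -/
def PeriodicFilamentLiouville : Prop :=
  ∀ (K A ℓ : ℝ) (W : ℝ → EuclideanSpace ℝ (Fin 3) → EuclideanSpace ℝ (Fin 3)),
    Literature.Analysis.FluidPDE.IsTypeIAncientMild K W → 0 < ℓ →
    (∀ τ < 0, IsX3Periodic ℓ (W τ)) → (∀ τ < 0, HasLinGrowth A (W τ)) → ∀ τ < 0, ∀ x, W τ x = 0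

/-- The rung settles the periodic sub-case of H (in its all-time-growth form): the zero field is not a tube slice (finite budget). -/
theorem not_isTubeSlice_periodic_of_rung (hR : PeriodicFilamentLiouville)
    (K A ℓ : ℝ) (W : ℝ → EuclideanSpace ℝ (Fin 3) → EuclideanSpace ℝ (Fin 3)) (s : ℝ)
    (hW : Literature.Analysis.FluidPDE.IsTypeIAncientMild K W) (hℓ : 0 < ℓ)
    (hper : ∀ τ < 0, IsX3Periodic ℓ (W τ)) (hgr : ∀ τ < 0, HasLinGrowth A (W τ)) (hs : s < 0) :
    ¬ IsTubeSlice (W s) := by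
  intro htube
  have h0 : W s = 0 := by
    funext x
    exact hR K A ℓ W hW hℓ hper hgr s hs x
  apply htube.2.2.2.1
  rw [h0]
  refine ⟨?_, ?_⟩ <;> simp

/-! ## §2e ALL-TIME VARIANT (rev 5): the zoom delivers the budget at EVERY rescaled time — stubs T2′, G′ (provable) and heart H′ ≤ H

The canonical composition (§3) feeds H only the growth of the selected slice `W s`.  But the ancient field `W` produced by KNSS
compactness is the local limit of the zoomed FLOWS, and F1 holds at all late physical times, so `W` inherits `HasLinGrowth A (W τ)`
at EVERY `τ < 0` (Fatou on balls at each `τ`; the physical times `t n + (ν/(Mb n)²)(τ - s)` are late and `< T` eventually by the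
Type-I pinning `(Mb n)²(T - t n)/ν → -s`).  Recording this costs two provable stubs — T2′ `ZoomPackageFlow` (δ's T2 with the
flow-level convergence KNSS Lemma 6.1 actually proves, and the pinning limit) and G′ `GrowthTransferFlow` (G's change of variables
+ Fatou, per `τ`) — and weakens the heart to H′ `NoFilamentTubeSliceAllTime` (growth at all times in the hypothesis; `H → H′`
kernel-checked below), whose `x₃`-periodic sub-case is exactly RUNG R1 (§2d).  The alternative composition §3b concludes the crux
BY NAME from F1, T1, T2′, G′, H′. -/

/-- FLOW-LEVEL ZOOM COMPACTNESS (conclusion of T2′): along any centres `y n` (zoomed units) and any subsequence `φ`, a further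
subsequence of the translated NS-compatible zoomed FLOWS `(τ, z) ↦ (Mb n)⁻¹ • u (t n + (ν/(Mb n)²)(τ - s)) ((ν/Mb n) • (y n + z))`
converges pointwise at every rescaled time `τ < 0` to a Type-I ancient mild field `W` (the slice family is the instance `τ = s`),
with the Type-I pinning `(Mb n)²(T - t n)/ν → -s` (the blow-up time sits at rescaled time `0`). -/
def ZoomCompactFlow (ν T : ℝ) (u : ℝ → E3 → E3) (t Mb : ℕ → ℝ) : Prop :=
  ∀ (y : ℕ → E3) (φ : ℕ → ℕ), StrictMono φ →
    ∃ (ψ : ℕ → ℕ) (K s : ℝ) (W : ℝ → E3 → E3), StrictMono ψ ∧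
      Literature.Analysis.FluidPDE.IsTypeIAncientMild K W ∧ s < 0 ∧
      Tendsto (fun n => Mb (φ (ψ n)) ^ 2 * (T - t (φ (ψ n))) / ν) atTop (𝓝 (-s)) ∧
      ∀ τ : ℝ, τ < 0 → ∀ z : E3,
        Tendsto (fun n => (Mb (φ (ψ n)))⁻¹ •
            u (t (φ (ψ n)) + ν / Mb (φ (ψ n)) ^ 2 * (τ - s)) ((ν / Mb (φ (ψ n))) • (y (φ (ψ n)) + z)))
          atTop (𝓝 (W τ z))

/-- (T2′ — glue, provable, M/L: δ's T2 + the flow-level convergence of KNSS 2009 Lemma 6.1 + the pinning limit along the subsequence)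
ZOOM PACKAGE, FLOW LEVEL. -/
def ZoomPackageFlow : Prop :=
  ∀ (C ν T : ℝ) (u : ℝ → E3 → E3) (p : ℝ → E3 → ℝ),
    IsViolator C ν T u p → ∀ (Θ : ℝ) (t Mb ε : ℕ → ℝ), EfficientTimesData ν T u Θ t Mb ε →
      ∃ (σ : ℕ → ℕ) (Λ : ℕ → ℝ) (Θ' : ℝ) (ε' : ℕ → ℝ), StrictMono σ ∧
        NearExtremalFamily (fun n y => (Mb (σ n))⁻¹ • u (t (σ n)) ((ν / Mb (σ n)) • y)) Λ Θ' ε' ∧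
        ZoomCompactFlow ν T u (fun n => t (σ n)) (fun n => Mb (σ n))

/-- (G′ — glue, provable, S/M) GROWTH TRANSFER AT EVERY RESCALED TIME: the physical budget (F1, eventually before `T`) passes to the
pointwise limit at rescaled time `τ < 0` of the translated zoomed flows with the SAME constant: the physical times
`t n + (ν/(Mb n)²)(τ - s) → T` and are `< T` eventually (pinning: `ν/(Mb n)² ∼ (T - t n)/(-s)`, `T - t n^τ ∼ (T - t n)·τ/s > 0`),
the zoom is budget-invariant (`(Mb n)⁻²·(Mb n/ν)³·ν²·(ν/Mb n) = 1`, landed `ballEnergy_zoom_le`), and Fatou on each ball.  (`0 < T` and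
slice continuity on `[0,T)` keep the budget hypothesis honest: without measurability the Bochner junk value would make it vacuous.) -/
def GrowthTransferFlow : Prop :=
  ∀ (ν A T : ℝ) (u : ℝ → E3 → E3) (t Mb : ℕ → ℝ) (y : ℕ → E3) (s τ : ℝ) (Wτ : E3 → E3),
    0 < ν → 0 < T → (∀ n, 0 < Mb n) → (∀ n, t n < T) → Tendsto t atTop (𝓝 T) →
    (∀ t' ∈ Set.Ico 0 T, Continuous (u t')) →
    (∀ᶠ t' in 𝓝[<] T, ∀ (x : E3) (r : ℝ), 0 < r → ∫ z in Metric.ball x r, ‖u t' z‖ ^ 2 ≤ A * ν ^ 2 * r) →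
    s < 0 → Tendsto (fun n => Mb n ^ 2 * (T - t n) / ν) atTop (𝓝 (-s)) → τ < 0 →
    (∀ z : E3, Tendsto (fun n => (Mb n)⁻¹ • u (t n + ν / Mb n ^ 2 * (τ - s)) ((ν / Mb n) • (y n + z))) atTop (𝓝 (Wτ z))) →
    HasLinGrowth A Wτ

/-- (H′ — THE OPEN HEART, all-time form; WEAKER than H) NO FILAMENT TUBE SLICE for Type-I ancient mild fields ALL of whose slices have
linear local-energy growth with one constant.  Its `x₃`-periodic sub-case is RUNG R1 `PeriodicFilamentLiouville` (§2d), its breathing-periodic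
sub-case RUNG R2 `BreathingPeriodicLiouville` (§2f); the free parameters of a would-be counterexample (a Type-I ancient NECKLACE: cell size
`≳ √(-τ)`, spacing law, phase pattern, no exact periodicity at any time, no time-dependent axial drift) are listed in THE NECKLACE BRIEF (§2f). -/
def NoFilamentTubeSliceAllTime : Prop :=
  ∀ (K A : ℝ) (W : ℝ → E3 → E3) (s : ℝ), Literature.Analysis.FluidPDE.IsTypeIAncientMild K W → s < 0 →
    (∀ τ : ℝ, τ < 0 → HasLinGrowth A (W τ)) → ¬ IsTubeSlice (W s)

/-- H′ is weaker than H (kernel-checked). -/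
theorem noFilamentTubeSliceAllTime_of_noFilamentTubeSlice (h : NoFilamentTubeSlice) : NoFilamentTubeSliceAllTime :=
  fun K A W s hW hs hgr => h K A W s hW hs (hgr s hs)

/-- T2′ is at least T2 (kernel-checked): forgetting the other times gives δ's zoom compactness of the slice family. -/
theorem zoomCompact_of_zoomCompactFlow {ν T : ℝ} {u : ℝ → E3 → E3} {t Mb : ℕ → ℝ}
    (h : ZoomCompactFlow ν T u t Mb) : ZoomCompact (fun n y => (Mb n)⁻¹ • u (t n) ((ν / Mb n) • y)) := by
  intro y φ hφ
  obtain ⟨ψ, K, s, W, hψ, hW, hs, -, hconv⟩ := h y φ hφ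
  refine ⟨ψ, K, s, W, hψ, hW, hs, fun z => ?_⟩
  have h1 := hconv s hs z
  simpa only [sub_self, mul_zero, add_zero] using h1

/-- RUNG R1 settles the `x₃`-periodic sub-case of H′ (kernel-checked restatement of `not_isTubeSlice_periodic_of_rung`). -/
theorem noFilamentTubeSliceAllTime_periodic_of_rung (hR : PeriodicFilamentLiouville) :
    ∀ (K A ℓ : ℝ) (W : ℝ → E3 → E3) (s : ℝ), Literature.Analysis.FluidPDE.IsTypeIAncientMild K W → 0 < ℓ →
      (∀ τ < 0, IsX3Periodic ℓ (W τ)) → s < 0 → (∀ τ : ℝ, τ < 0 → HasLinGrowth A (W τ)) → ¬ IsTubeSlice (W s) :=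
  fun K A ℓ W s hW hℓ hper hs hgr => not_isTubeSlice_periodic_of_rung hR K A ℓ W s hW hℓ hper hgr hs

/-! ## §2f RUNG R2 «breathing-periodic necklaces are dead» + THE NECKLACE BRIEF (rev 6; critic ASK (ii), verdict 2026-08-29T01:29Z)

RUNG R2 (OFFERED STATEMENT, provable NOW from landed pieces, size S/M, GROWTH-FREE): a Type-I ancient mild field which at every time
`τ < 0` is `x₃`-periodic with a period `h τ` depending continuously and injectively on `τ` (e.g. the self-similar spacing
`h τ = L·√(-τ)` of a (discretely) self-similar necklace with `ξ₃`-periodic profile) vanishes identically.  Proof sketch (three landed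
inputs, no energy / growth / pressure): fix `τ₀ < 0`; `x ↦ W τ (x + h τ₀ • e₃)` is again a bounded Oseen-mild solution on `[τ₀, T′]`
for every `T′ < 0` (spatial translation covariance of `heatFlow` / `oseenDuhamel`; Type-I bound `K/√(-T′)`) with the same slice at
`τ₀` (periodicity at `τ₀`), so forward uniqueness `Literature.Analysis.FluidPDE.oseenMild_bounded_unique` makes `h τ₀` a period of
`W τ` for every `τ ∈ [τ₀, 0)`; hence the `x₃`-periods of `W τ` contain `h '' [τ - 1, τ]`, a non-degenerate interval (continuity,
injectivity, IVT); differences of periods are periods, so every real number is one: `W τ` is invariant along `e₃` for every `τ < 0`;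
the landed line-invariant Liouville theorem `Literature.Analysis.FluidPDE.apply_eq_apply_zero_of_invariant_along` (KNSS Thm 5.1;
apply it to the bounded time-shifts `W (· - δ)`, `δ > 0`) makes every slice spatially constant and
`Literature.Analysis.FluidPDE.IsTypeIAncientMild.eq_zero_of_slice_const` makes it zero.  With R1 (FIXED period `ℓ`; per ns-net-p2
2026-08-29T01:34Z the linear-growth hypothesis is idle there as well: the fixed period makes very negative times subcritical) this
says: A COUNTEREXAMPLE TO H′ HAS NO EXACT DISCRETE TRANSLATION SYMMETRY AT ANY TIME under any continuous period law `h`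
(`h` constant on some `(-∞, τ*]`: R1 on the Type-I time-shift `τ ↦ W (τ + τ*)` + forward uniqueness; `h` non-constant on every
`(-∞, τ]`: R2's interval-of-periods argument at each `τ`).

THE NECKLACE BRIEF — free parameters of the one enemy left, for a construction / cdisprove seat.  A refutation of H′ is a Type-I
ancient mild `W` (constant `K`), a time `s < 0`, `HasLinGrowth A (W τ)` for all `τ < 0`, and `IsTubeSlice (W s)` (infinite `Ḣ¹`/`Ḣ²`
budget at time `s`: infinitely many cells).  Forced features: (a) CELL SIZE `≳ √(-τ)` for cells of Type-I amplitude (KNSS smoothing,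
`‖∇W(τ)‖_∞ ≲ K′/(-τ)`); (b) SPACING: cells carrying the Type-I amplitude `≍ K/√(-τ)` on radius `≍ √(-τ)` cost `≍ K²√(-τ)` each, and
`B(x,R)` may hold energy `≤ A R`, so their spacing is `d(τ) ≳ K²√(-τ)/A` — dilute or self-similarly spaced, never denser (weaker
cells may sit closer); (c) NO EXACT `x₃`-PERIODICITY OF ANY SLICE at any time (THEOREM since rev 11: R3 `periodicSliceLiouville_holds`; covers breathing laws R2, helically symmetric necklaces — the screw group contains the translation by the pitch — and self-similar / discretely self-similar
necklaces with a `ξ₃`-periodic profile); (e) NO VACUUM POCKET IN ANY SLICE: no slice `W τ` vanishes on a non-empty open set (THEOREM, R4′ `noSliceVacuumPocket_holds` ⊋ R4) — cells are analytic tails of one another, never surgically separated, at every single time; (g) NO LOCAL REPETITION IN ANY DIRECTION: no slice agrees with any of its translates on any open patch (THEOREM, R3″ `noLocalRepetition_anyDirection`) — no two cells are exact copies of each other even locally; (h) ONE CELL DETERMINES ALL: the germ of one slice on one patch fixes the field at all times (THEOREM, R7 `sliceGermRigidity_holds`) and every symmetry seen locally once is global and eternal (`isometryInvariant_allTime_of_local`)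 — in particular no slice is locally axisymmetric if `r‖W‖ ≤ C` (R5′) and no rational-twist screw symmetry (THEOREM, R8-fin); an IRRATIONAL-TWIST screw-symmetric necklace (cell `n` = cell `0` rotated by `nα`, `α/2π ∉ ℚ`) is the named survivor of this family (open rung R8 `ScrewSymmetricLiouville`); (f) NOT AXISYMMETRIC with `r‖W‖ ≤ C` at all times (THEOREM, R5); (d) FRAME: constant Galilean boosts are harmless, a time-dependent axial drift `b(τ)` is the
parasitic gauge excluded by the Oseen/KNSS mild formulation (KNSS 2009 §1).  Free parameters that remain: the spacing law
(`d(τ)/√(-τ) → ∞` backward, or quasi-periodic / disordered positions at ratio `O(1)`); the phase pattern along the chain (coaxial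
vortex rings of one sign = jet-like, alternating = wake-like, a helical twist angle per cell); breathing (cells appearing / merging
along the flow); the per-cell profile (the route context says near-`K⋆`-extremal heads, but H′ quantifies over ALL Type-I necklaces,
so a refuter may use any profile).  Nearest print: backward SELF-SIMILAR solutions are trivial under local energy estimates
(Nečas–Růžička–Šverák 1996 `U ∈ L³`, Tsai 1998; [corpus: book:lemarie-rieusset2016 Thm 16.8 p. 630]) — a `ξ₃`-periodic profile has
bounded local energy but log-divergent local enstrophy `∫_{-1}^{0}∫_{B(0,1)}|∇u|² = ∞`, so Thm 16.8 does not cover it; (c) does.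
-/

/-- RUNG R2 «breathing-periodic necklaces are dead» (OFFERED STATEMENT; growth-free; provable now from `oseenMild_bounded_unique`,
`apply_eq_apply_zero_of_invariant_along`, `IsTypeIAncientMild.eq_zero_of_slice_const`; size S/M; not a registered stub of this line). -/
def BreathingPeriodicLiouville : Prop :=
  ∀ (K : ℝ) (W : ℝ → E3 → E3) (h : ℝ → ℝ), Literature.Analysis.FluidPDE.IsTypeIAncientMild K W →
    ContinuousOn h (Set.Iio 0) → Set.InjOn h (Set.Iio 0) →
    (∀ τ : ℝ, τ < 0 → IsX3Periodic (h τ) (W τ)) → ∀ τ : ℝ, τ < 0 → ∀ x, W τ x = 0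

/-- R2 settles the breathing-periodic sub-case of H′ (kernel-checked; the growth hypothesis is not even used). -/
theorem noFilamentTubeSliceAllTime_breathing_of_rung2 (hR : BreathingPeriodicLiouville) :
    ∀ (K A : ℝ) (W : ℝ → E3 → E3) (h : ℝ → ℝ) (s : ℝ), Literature.Analysis.FluidPDE.IsTypeIAncientMild K W →
      ContinuousOn h (Set.Iio 0) → Set.InjOn h (Set.Iio 0) → (∀ τ : ℝ, τ < 0 → IsX3Periodic (h τ) (W τ)) → s < 0 →
      (∀ τ : ℝ, τ < 0 → HasLinGrowth A (W τ)) → ¬ IsTubeSlice (W s) := by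
  intro K A W h s hW hcont hinj hper hs _ htube
  have h0 : W s = 0 := by
    funext x
    exact hR K W h hW hcont hinj hper s hs x
  apply htube.2.2.2.1
  rw [h0]
  refine ⟨?_, ?_⟩ <;> simp

/-! ## §2g RUNG R3 «one exactly periodic slice kills» (rev 7): forward uniqueness ⊕ TIME ANALYTICITY (Dong–Zhang 2020) ⊕ R1′

The period group of a slice can only GROW forward in time (R2's proof), so an exactly periodic necklace's period law is piecewise constant,
refining forward by integer factors — R1 (constant law) and R2 (injective law) leave the PERIOD-REFINEMENT CASCADE (period `2^k ℓ` on
`(τ_{k+1}, τ_k]`, `τ_k → -∞`: symmetry ACQUIRED forward in time at each `τ_k`).  Symmetry acquisition is forbidden by UNIQUE CONTINUATION IN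
TIME, which bounded mild solutions enjoy because they are REAL-ANALYTIC IN TIME: Dong–Zhang, *Time analyticity for the heat equation and
Navier–Stokes equations*, JFA 279 (2020) 108563 = arXiv:1907.01687, Thm 2 [corpus: paper:arxiv-1907.01687 p.7]: a mild solution with
`|u| ≤ C₂` on `[0,1] × ℝ^d` satisfies `sup_t tⁿ‖∂ⁿ_t u(t)‖_∞ ≤ N^{n+1} nⁿ`, hence is analytic in time (the authors note the unique-continuation
consequence, p. 3).  So: if ONE slice `W τ₁` is exactly `ℓ`-periodic, forward uniqueness makes `W τ` `ℓ`-periodic for `τ ≥ τ₁`, the pointwise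
differences `σ ↦ W σ (x + ℓ•e₃) - W σ x` are real-analytic on `(-∞, 0)` and vanish on `(τ₁, 0)`, hence vanish identically (identity theorem,
Mathlib `AnalyticOnNhd.eqOn_zero_of_preconnected_of_eventuallyEq_zero`): `W` is `ℓ`-periodic at ALL times and R1′ (the growth-free periodic
Liouville theorem being landed by ns-net-p1/p2) gives `W ≡ 0`.  RUNG R3 = «a Type-I ancient mild field with one exactly `x₃`-periodic slice
is zero»; for H′: THE SELECTED SLICE `W s` OF A COUNTEREXAMPLE IS NEVER EXACTLY PERIODIC, and neither is any other slice (subsumes R1, R2 and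
the cascade).  The composition `periodicSliceLiouville_of` below is kernel-checked from three named inputs: P `ForwardPeriodicity` (provable
now: translation covariance + `oseenMild_bounded_unique`), A `TypeIAncientMildTimeAnalytic` (Dong–Zhang Thm 2, pointwise form; a Literature
fact to land), R1′ `PeriodicTypeILiouville`. -/

/-- P — FORWARD PERIODICITY (provable now, size S/M): an `ℓ`-periodic slice stays `ℓ`-periodic at all later times (the translate
`x ↦ W τ (x + ℓ•e₃)` is an Oseen-mild solution from `τ₁` with the same data; `Literature.Analysis.FluidPDE.oseenMild_bounded_unique`). -/
def ForwardPeriodicity : Prop :=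
  ∀ (K ℓ : ℝ) (W : ℝ → E3 → E3) (τ₁ : ℝ), Literature.Analysis.FluidPDE.IsTypeIAncientMild K W → τ₁ < 0 →
    IsX3Periodic ℓ (W τ₁) → ∀ τ : ℝ, τ₁ ≤ τ → τ < 0 → IsX3Periodic ℓ (W τ)

/-- **P holds** (kernel-checked, rev 8): forward propagation of a spatial period IS the tree's
`IsTypeIAncientMild.comp_add_eq_after` (Barker–Prange 2020, proof of Prop. 4 Step 3, via the uniqueness of bounded
Oseen-mild solutions, KNSS 2009 §4 — `translationInvariant_after_of_oseenMild`). -/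
theorem forwardPeriodicity_holds : ForwardPeriodicity := by
  intro K ℓ W τ₁ hW hτ₁ hper τ hle hτ0
  rcases eq_or_lt_of_le hle with h | h
  · subst h; exact hper
  · intro x
    exact hW.comp_add_eq_after hτ₁ hper τ h hτ0 x

/-- A — TIME ANALYTICITY of Type-I ancient mild fields, pointwise form. **PROVABLE FROM THE TREE NOW (rev 8; free prover task, size M)**:
follow `IsTypeIAncientMild.analyticOnNhd_slice_univ` (`Literature/Analysis/FluidPDE/BarkerPrange2020VorticityAlignmentTypeIHolds.lean` :117,
the spatial twin) — the PROVED fact `lemarieRieusset2016_local_analyticity_holds` gives a JOINTLY space–time real-analytic Oseen fixed point `v`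
on a window `(s, s + ε/M²) × ℝ³` from the bounded datum `W s` (`s := τ - δ`, `M := K/√(-τ/2)`, `δ < ε(-τ/2)/K²`), `oseenMild_bounded_unique`
identifies `v = W` on the window (a.e., then pointwise by continuity), `σ ↦ (σ, x)` is analytic, so `σ ↦ v σ x` is `AnalyticAt` at `τ`, and
`AnalyticAt.congr` transfers it to `σ ↦ W σ x`. (Sharper quantitative source, not needed: Dong–Zhang 2020 Thm 2, `sup tⁿ‖∂ⁿ_t u‖_∞ ≤ N^{n+1}nⁿ`.)
[cite: LemarieRieusset2016, Thm. 9.12 (PDF p. 260); DongZhang2020, Thm 2 (arXiv:1907.01687 p. 7)] -/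
def TypeIAncientMildTimeAnalytic : Prop :=
  ∀ (K : ℝ) (W : ℝ → E3 → E3), Literature.Analysis.FluidPDE.IsTypeIAncientMild K W →
    ∀ (x : E3) (τ : ℝ), τ < 0 → AnalyticAt ℝ (fun σ : ℝ => W σ x) τ

/-- **A holds** (kernel-checked, rev 11): pointwise time analyticity is the restriction along `σ ↦ (σ, x)` of the JOINT space–time
analyticity `analyticOnNhd_uncurry_of_oseenMild` (tree, `Theorems/ClockStretchingLawSteadySliceLiouvilleAnalytic.lean`, from the PROVED
`lemarieRieusset2016_local_analyticity_holds` + `oseenMild_bounded_unique`), fed with clauses 1, 3, 4 of `IsTypeIAncientMild`. -/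
theorem typeIAncientMildTimeAnalytic_holds : TypeIAncientMildTimeAnalytic := by
  intro K W hW x τ hτ
  have hj : AnalyticOnNhd ℝ (Function.uncurry W) (Set.Iio 0 ×ˢ (Set.univ : Set E3)) :=
    Summit.NavierStokesRegularity.NavierStokesRegularity.Theorems.analyticOnNhd_uncurry_of_oseenMild hW.1
      (fun s t hst ht y => hW.mild_eq_heatExtension hst ht y) hW.hasTypeITimeDecay
  have hpt : AnalyticAt ℝ (Function.uncurry W) (τ, x) := hj (τ, x) (Set.mk_mem_prod hτ (Set.mem_univ x))
  exact hpt.curry_left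

/-- R1′ — GROWTH-FREE PERIODIC LIOUVILLE (ns-net-p2 2026-08-29T01:34Z: the linear-growth hypothesis of R1 is idle; being landed as
`Theorems/ExtremiserTransiencePeriodicFilamentLiouvilleX3Independent.lean` + Literature lemma B1 by ns-net-p1 g4 / ns-net-p2 g6). -/
def PeriodicTypeILiouville : Prop :=
  ∀ (K ℓ : ℝ) (W : ℝ → E3 → E3), Literature.Analysis.FluidPDE.IsTypeIAncientMild K W → 0 < ℓ →
    (∀ τ : ℝ, τ < 0 → IsX3Periodic ℓ (W τ)) → ∀ τ : ℝ, τ < 0 → ∀ x, W τ x = 0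

/-- **R1′ holds** (kernel-checked, rev 11): the growth-free periodic Liouville theorem LANDED by ns-net-p1 g4 (p688344 / p689280,
`Theorems/ExtremiserTransienceTypeIAncientAxiallyPeriodicLiouville.lean` + `…PeriodicFilamentLiouville.lean`: axial average + strict heat
contraction on zero-mean periodic data + KNSS line-invariant Liouville), cited BY NAME. -/
theorem periodicTypeILiouville_holds : PeriodicTypeILiouville :=
  fun K ℓ W hW hℓ hper =>
    Summit.NavierStokesRegularity.NavierStokesRegularity.Theorems.NearExtremalTransiencePerFlow.FilamentSelection.eq_zero_of_isX3Periodic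
      hW hℓ hper

/-- R1′ ⇒ R1 (kernel-checked: the growth hypothesis is simply dropped). -/
theorem periodicFilamentLiouville_of_periodicTypeILiouville (h : PeriodicTypeILiouville) : PeriodicFilamentLiouville :=
  fun K _ ℓ W hW hℓ hper _ τ hτ x => h K ℓ W hW hℓ (fun τ' hτ' => hper τ' hτ') τ hτ x

/-- RUNG R3 «one exactly periodic slice kills» (OFFERED STATEMENT): a Type-I ancient mild field with ONE exactly `x₃`-periodic slice is zero. -/
def PeriodicSliceLiouville : Prop :=
  ∀ (K ℓ : ℝ) (W : ℝ → E3 → E3) (τ₁ : ℝ), Literature.Analysis.FluidPDE.IsTypeIAncientMild K W → 0 < ℓ → τ₁ < 0 →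
    IsX3Periodic ℓ (W τ₁) → ∀ τ : ℝ, τ < 0 → ∀ x, W τ x = 0

/-- **R3 ⇐ P ∧ A ∧ R1′** (kernel-checked): forward periodicity, unique continuation in time by analyticity, periodic Liouville. -/
theorem periodicSliceLiouville_of (hP : ForwardPeriodicity) (hA : TypeIAncientMildTimeAnalytic) (hR : PeriodicTypeILiouville) :
    PeriodicSliceLiouville := by
  intro K ℓ W τ₁ hW hℓ hτ₁ hper τ hτ x
  refine hR K ℓ W hW hℓ ?_ τ hτ x
  -- `ℓ`-periodicity at every time `σ < 0`, pointwise in `y`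
  intro σ hσ y
  set e3 : E3 := EuclideanSpace.single (2 : Fin 3) (1 : ℝ) with he3
  -- the pointwise difference is real-analytic on `(-∞, 0)` …
  set d : ℝ → E3 := fun σ' => W σ' (y + ℓ • e3) - W σ' y with hd
  have hdA : AnalyticOnNhd ℝ d (Set.Iio 0) := by
    intro σ' hσ'
    exact (hA K W hW (y + ℓ • e3) σ' hσ').sub (hA K W hW y σ' hσ')
  -- … and vanishes on the open interval `(τ₁, 0)` by forward periodicity
  have hz₀ : τ₁ / 2 ∈ Set.Iio (0 : ℝ) := by
    show τ₁ / 2 < 0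
    linarith
  have hev : d =ᶠ[𝓝 (τ₁ / 2)] 0 := by
    have hopen : IsOpen (Set.Ioo τ₁ 0) := isOpen_Ioo
    have hmem : τ₁ / 2 ∈ Set.Ioo τ₁ 0 := ⟨by linarith, by linarith⟩
    filter_upwards [hopen.mem_nhds hmem] with σ' hσ'
    have hp := hP K ℓ W τ₁ hW hτ₁ hper σ' hσ'.1.le hσ'.2 y
    simp only [hd, Pi.zero_apply, sub_eq_zero]
    exact hp
  have hzero := hdA.eqOn_zero_of_preconnected_of_eventuallyEq_zero isPreconnected_Iio hz₀ hev
  have hσ0 : d σ = 0 := hzero hσ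
  simp only [hd, sub_eq_zero] at hσ0
  exact hσ0

/-- **R3 ⇐ A ∧ R1′** (kernel-checked, rev 8: P discharged by `forwardPeriodicity_holds`; A is tree-provable, R1′ is being landed). -/
theorem periodicSliceLiouville_of_timeAnalytic (hA : TypeIAncientMildTimeAnalytic) (hR : PeriodicTypeILiouville) :
    PeriodicSliceLiouville :=
  periodicSliceLiouville_of forwardPeriodicity_holds hA hR

/-- R3 settles every «exactly periodic slice» sub-case of H′ — in particular THE SELECTED SLICE `W s` of a counterexample is never periodic
(kernel-checked; growth unused). -/
theorem noFilamentTubeSliceAllTime_periodicSlice_of_rung3 (hR : PeriodicSliceLiouville) :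
    ∀ (K A ℓ : ℝ) (W : ℝ → E3 → E3) (s : ℝ), Literature.Analysis.FluidPDE.IsTypeIAncientMild K W → 0 < ℓ → s < 0 →
      IsX3Periodic ℓ (W s) → (∀ τ : ℝ, τ < 0 → HasLinGrowth A (W τ)) → ¬ IsTubeSlice (W s) := by
  intro K A ℓ W s hW hℓ hs hper _ htube
  have h0 : W s = 0 := by
    funext x
    exact hR K ℓ W s hW hℓ hs hper s hs x
  apply htube.2.2.2.1
  rw [h0]
  refine ⟨?_, ?_⟩ <;> simp

/-- R3 ⇒ R2 for positive period laws (kernel-checked; any one slice is periodic — continuity / injectivity of the law unused) and R3 ⇒ R1′. -/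
theorem breathingPeriodicLiouville_of_periodicSliceLiouville (hR : PeriodicSliceLiouville) :
    ∀ (K : ℝ) (W : ℝ → E3 → E3) (h : ℝ → ℝ), Literature.Analysis.FluidPDE.IsTypeIAncientMild K W →
      (∀ τ : ℝ, τ < 0 → 0 < h τ) → (∀ τ : ℝ, τ < 0 → IsX3Periodic (h τ) (W τ)) → ∀ τ : ℝ, τ < 0 → ∀ x, W τ x = 0 :=
  fun K W h hW hpos hper τ hτ x => hR K (h τ) W τ hW (hpos τ hτ) hτ (hper τ hτ) τ hτ x

theorem periodicTypeILiouville_of_periodicSliceLiouville (hR : PeriodicSliceLiouville) : PeriodicTypeILiouville :=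
  fun K ℓ W hW hℓ hper τ hτ x => hR K ℓ W τ hW hℓ hτ (hper τ hτ) τ hτ x

/-! #### §2g′ (rev 11) THE PERIODIC FAMILY IS CLOSED — R1, R1′, R2, R3 are THEOREMS (kernel-checked, no stub used).
With A (`typeIAncientMildTimeAnalytic_holds`) and R1′ (`periodicTypeILiouville_holds`) now proved from the tree, every rung of the periodic
family is unconditional: R3 `PeriodicSliceLiouville` (one periodic slice at one time kills the field), hence R2 (breathing laws) and R1. -/

/-- A negative period is a period. -/
theorem isX3Periodic_neg {ℓ : ℝ} {w : E3 → E3} (h : IsX3Periodic ℓ w) : IsX3Periodic (-ℓ) w := by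
  intro x
  have hx := h (x + (-ℓ) • EuclideanSpace.single (2 : Fin 3) (1 : ℝ))
  rw [neg_smul, neg_add_cancel_right] at hx
  rw [neg_smul]
  exact hx.symm

/-- **R3 holds** (rev 11): a Type-I ancient mild field with ONE exactly `x₃`-periodic slice (period `ℓ > 0`, at one time `τ₁ < 0`) vanishes
identically — UNCONDITIONAL (P `forwardPeriodicity_holds` + A `typeIAncientMildTimeAnalytic_holds` + R1′ `periodicTypeILiouville_holds`). -/
theorem periodicSliceLiouville_holds : PeriodicSliceLiouville :=
  periodicSliceLiouville_of_timeAnalytic typeIAncientMildTimeAnalytic_holds periodicTypeILiouville_holds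

/-- **R1 holds** (rev 11; = p689280 `…FilamentSelection.periodicFilamentLiouville`, here through R1′). -/
theorem rung_R1 : PeriodicFilamentLiouville :=
  periodicFilamentLiouville_of_periodicTypeILiouville periodicTypeILiouville_holds

/-- **R2 holds** (rev 11): breathing-periodic Type-I ancient mild fields vanish — UNCONDITIONAL.  An injective law has at most one zero, so
some slice among `τ = -1, -2` has a non-zero period, made positive by `isX3Periodic_neg`; then R3. (Continuity of the law is not even used.) -/
theorem breathingPeriodicLiouville_holds : BreathingPeriodicLiouville := by
  intro K W h hW _ hinj hper τ hτ x
  -- a time τ₁ ∈ {-1, -2} with h τ₁ ≠ 0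
  obtain ⟨τ₁, hτ₁, hne⟩ : ∃ τ₁ : ℝ, τ₁ < 0 ∧ h τ₁ ≠ 0 := by
    by_cases h1 : h (-1) = 0
    · refine ⟨-2, by norm_num, fun h2 => ?_⟩
      have := hinj (show (-1 : ℝ) ∈ Set.Iio 0 by norm_num) (show (-2 : ℝ) ∈ Set.Iio 0 by norm_num) (h1.trans h2.symm)
      norm_num at this
    · exact ⟨-1, by norm_num, h1⟩
  rcases hne.lt_or_gt with hlt | hgt
  · exact periodicSliceLiouville_holds K (-h τ₁) W τ₁ hW (neg_pos.2 hlt) hτ₁ (isX3Periodic_neg (hper τ₁ hτ₁)) τ hτ x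
  · exact periodicSliceLiouville_holds K (h τ₁) W τ₁ hW hgt hτ₁ (hper τ₁ hτ₁) τ hτ x

/-- **Periodic sub-cases of H′ are SETTLED** (rev 11, unconditional): no slice of a counterexample to H′ is exactly `x₃`-periodic at any time. -/
theorem noFilamentTubeSliceAllTime_periodicSlice :
    ∀ (K A ℓ : ℝ) (W : ℝ → E3 → E3) (s : ℝ), Literature.Analysis.FluidPDE.IsTypeIAncientMild K W → 0 < ℓ → s < 0 →
      IsX3Periodic ℓ (W s) → (∀ τ : ℝ, τ < 0 → HasLinGrowth A (W τ)) → ¬ IsTubeSlice (W s) :=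
  noFilamentTubeSliceAllTime_periodicSlice_of_rung3 periodicSliceLiouville_holds

theorem noFilamentTubeSliceAllTime_breathing :
    ∀ (K A : ℝ) (W : ℝ → E3 → E3) (h : ℝ → ℝ) (s : ℝ), Literature.Analysis.FluidPDE.IsTypeIAncientMild K W →
      ContinuousOn h (Set.Iio 0) → Set.InjOn h (Set.Iio 0) → (∀ τ : ℝ, τ < 0 → IsX3Periodic (h τ) (W τ)) → s < 0 →
      (∀ τ : ℝ, τ < 0 → HasLinGrowth A (W τ)) → ¬ IsTubeSlice (W s) :=
  noFilamentTubeSliceAllTime_breathing_of_rung2 breathingPeriodicLiouville_holds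

/-! ### §2h RUNG R4 «no space–time vacuum pocket» (rev 9; kernel-reduced to A alone + the tree)

A refuter's cheapest route to a counterexample necklace for H′ is SURGERY: glue compactly supported cells with exact vacuum
between them.  Exact solutions forbid it: slices of Type-I ancient mild fields are real-analytic in space (tree,
`IsTypeIAncientMild.analyticOnNhd_slice_univ`) and — input A — in time, so a field vanishing on any open space–time box
`(τ₁, τ₂) × U` vanishes identically (identity theorem twice).  For the necklace brief: the enemy has NO vacuum anywhere, at any
time; every cell's analytic tail couples to all the others (one jet at one point determines the slice). -/

/-- R4 — NO SPACE–TIME VACUUM POCKET: a Type-I ancient mild field vanishing on an open box `(τ₁, τ₂) × U` (`U` open, non-empty,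
`τ₁ < τ₂ < 0`) is identically zero. -/
def NoVacuumPocket : Prop :=
  ∀ (K : ℝ) (W : ℝ → E3 → E3) (U : Set E3) (τ₁ τ₂ : ℝ), Literature.Analysis.FluidPDE.IsTypeIAncientMild K W →
    IsOpen U → U.Nonempty → τ₁ < τ₂ → τ₂ < 0 → (∀ σ ∈ Set.Ioo τ₁ τ₂, ∀ x ∈ U, W σ x = 0) →
    ∀ σ : ℝ, σ < 0 → ∀ x, W σ x = 0

/-- **R4 ⇐ A** (kernel-checked, rev 9): time analyticity along each `x ∈ U` spreads the vanishing to all `σ < 0` on `U`;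
spatial analyticity of the slice (tree) spreads it to all of `ℝ³`. -/
theorem noVacuumPocket_of_timeAnalytic (hA : TypeIAncientMildTimeAnalytic) : NoVacuumPocket := by
  intro K W U τ₁ τ₂ hW hU hne h12 h2 hvac σ hσ
  -- step 1: along every `x ∈ U` the time signal vanishes for all negative times
  have h1 : ∀ x ∈ U, ∀ σ' : ℝ, σ' < 0 → W σ' x = 0 := by
    intro x hx σ' hσ'
    have han : AnalyticOnNhd ℝ (fun σ : ℝ => W σ x) (Set.Iio 0) := fun σ hσ0 => hA K W hW x σ hσ0
    have hm : (τ₁ + τ₂) / 2 ∈ Set.Iio (0 : ℝ) := by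
      simp only [Set.mem_Iio]; linarith
    have hev : (fun σ : ℝ => W σ x) =ᶠ[𝓝 ((τ₁ + τ₂) / 2)] 0 := by
      have hI : Set.Ioo τ₁ τ₂ ∈ 𝓝 ((τ₁ + τ₂) / 2) := Ioo_mem_nhds (by linarith) (by linarith)
      filter_upwards [hI] with σ'' hσ''
      exact hvac σ'' hσ'' x hx
    exact han.eqOn_zero_of_preconnected_of_eventuallyEq_zero isPreconnected_Iio hm hev hσ'
  -- step 2: the slice at time `σ` vanishes on the open non-empty `U`, hence everywhere
  have hsp : AnalyticOnNhd ℝ (W σ) Set.univ := hW.analyticOnNhd_slice_univ hσ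
  obtain ⟨x₀, hx₀⟩ := hne
  have hev2 : W σ =ᶠ[𝓝 x₀] 0 := by
    filter_upwards [hU.mem_nhds hx₀] with x hx
    exact h1 x hx σ hσ
  have hz := hsp.eqOn_zero_of_preconnected_of_eventuallyEq_zero isPreconnected_univ (Set.mem_univ x₀) hev2
  intro x
  exact hz (Set.mem_univ x)

/-- **R4 holds** (rev 11): no space–time vacuum pocket in a non-trivial Type-I ancient mild field — UNCONDITIONAL (A proved). -/
theorem noVacuumPocket_holds : NoVacuumPocket :=
  noVacuumPocket_of_timeAnalytic typeIAncientMildTimeAnalytic_holds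

/-- R4′ — NO VACUUM POCKET IN ANY SINGLE SLICE (rev 12): if ONE slice `W s` of a Type-I ancient mild field vanishes on a non-empty open
set, the field is identically zero.  Strictly stronger than R4 (a space–time pocket contains a slice pocket). -/
def NoSliceVacuumPocket : Prop :=
  ∀ (K : ℝ) (W : ℝ → E3 → E3) (U : Set E3) (s : ℝ), Literature.Analysis.FluidPDE.IsTypeIAncientMild K W →
    IsOpen U → U.Nonempty → s < 0 → (∀ x ∈ U, W s x = 0) → ∀ σ : ℝ, σ < 0 → ∀ x, W σ x = 0

/-- **R4′ holds** (kernel-checked, rev 12; UNCONDITIONAL): spatial analyticity of the slice (tree `analyticOnNhd_slice_univ`) spreads the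
vanishing over `ℝ³` at time `s`; the zero slice is invariant under EVERY translation, so by `comp_add_eq_after` (forward Oseen-mild uniqueness)
all later slices are spatially constant; time analyticity (A) carries «`W σ x = W σ 0`» back to all `σ < 0`; the gauge kills spatially constant
slices (`eq_zero_of_slice_const`). -/
theorem noSliceVacuumPocket_holds : NoSliceVacuumPocket := by
  intro K W U s hW hU hne hs hvac
  -- step 1: the slice at time `s` vanishes identically
  have hsp : AnalyticOnNhd ℝ (W s) Set.univ := hW.analyticOnNhd_slice_univ hs
  obtain ⟨x₀, hx₀⟩ := hne
  have hev : W s =ᶠ[𝓝 x₀] 0 := by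
    filter_upwards [hU.mem_nhds hx₀] with x hx
    exact hvac x hx
  have hz : ∀ x, W s x = 0 := fun x =>
    hsp.eqOn_zero_of_preconnected_of_eventuallyEq_zero isPreconnected_univ (Set.mem_univ x₀) hev (Set.mem_univ x)
  -- step 2: later slices are invariant under every translation, hence spatially constant
  have hconst : ∀ t, s < t → t < 0 → ∀ x, W t x = W t 0 := by
    intro t hst ht x
    have hb : ∀ y, W s (y + x) = W s y := fun y => by rw [hz, hz]
    have h := hW.comp_add_eq_after hs hb t hst ht 0
    rwa [zero_add] at h
  -- step 3: time analyticity carries spatial constancy back to all negative times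
  have hall : ∀ t < 0, ∀ x, W t x = (fun σ => W σ 0) t := by
    intro t ht x
    have han : AnalyticOnNhd ℝ (fun σ : ℝ => W σ x - W σ 0) (Set.Iio 0) := fun σ hσ0 =>
      (typeIAncientMildTimeAnalytic_holds K W hW x σ hσ0).sub (typeIAncientMildTimeAnalytic_holds K W hW 0 σ hσ0)
    have hm : s / 2 ∈ Set.Iio (0 : ℝ) := by
      simp only [Set.mem_Iio]; linarith
    have hev2 : (fun σ : ℝ => W σ x - W σ 0) =ᶠ[𝓝 (s / 2)] 0 := by
      have hI : Set.Ioo s 0 ∈ 𝓝 (s / 2) := Ioo_mem_nhds (by linarith) (by linarith)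
      filter_upwards [hI] with σ hσ
      simp only [Pi.zero_apply, sub_eq_zero]
      exact hconst σ hσ.1 hσ.2 x
    have h0 := han.eqOn_zero_of_preconnected_of_eventuallyEq_zero isPreconnected_Iio hm hev2 ht
    simpa [sub_eq_zero] using h0
  -- step 4: the gauge kills spatially constant slices
  intro σ hσ x
  exact hW.eq_zero_of_slice_const hall hσ x

/-- R4′ ⇒ R4 (kernel-checked): a space–time pocket `Ioo τ₁ τ₂ × U` contains the slice pocket at time `(τ₁ + τ₂)/2`. -/
theorem noVacuumPocket_of_noSliceVacuumPocket (h : NoSliceVacuumPocket) : NoVacuumPocket := by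
  intro K W U τ₁ τ₂ hW hU hne h12 h2 hvac σ hσ x
  have hm : (τ₁ + τ₂) / 2 ∈ Set.Ioo τ₁ τ₂ := ⟨by linarith, by linarith⟩
  exact h K W U ((τ₁ + τ₂) / 2) hW hU hne (by linarith) (fun y hy => hvac _ hm y hy) σ hσ x

/-- **Slice-pocket sub-case of H′ SETTLED** (rev 12, unconditional): the selected tube slice of a counterexample to H′ has NO open zero set —
its infinitely many cells are never separated by exact vacuum, even at the single time `s`. -/
theorem isTubeSlice_no_open_zero_set :
    ∀ (K : ℝ) (W : ℝ → E3 → E3) (U : Set E3) (s : ℝ), Literature.Analysis.FluidPDE.IsTypeIAncientMild K W →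
      IsOpen U → U.Nonempty → s < 0 → (∀ x ∈ U, W s x = 0) → ¬ IsTubeSlice (W s) := by
  intro K W U s hW hU hne hs hvac htube
  have h0 : W s = 0 := by
    funext x
    exact noSliceVacuumPocket_holds K W U s hW hU hne hs hvac s hs x
  apply htube.2.2.2.1
  rw [h0]
  refine ⟨?_, ?_⟩ <;> simp

/-- R3′ — NO LOCAL REPETITION (rev 12): if on some non-empty OPEN patch `U` one slice coincides with its own translate by `ℓ·e₃`
(`ℓ ≠ 0`) — two cells of the necklace being exact copies of each other near `U` — the field is identically zero. -/
def NoLocalRepetition : Prop :=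
  ∀ (K ℓ : ℝ) (W : ℝ → E3 → E3) (U : Set E3) (s : ℝ), Literature.Analysis.FluidPDE.IsTypeIAncientMild K W →
    IsOpen U → U.Nonempty → s < 0 → ℓ ≠ 0 →
    (∀ x ∈ U, W s (x + ℓ • EuclideanSpace.single (2 : Fin 3) (1 : ℝ)) = W s x) → ∀ σ : ℝ, σ < 0 → ∀ x, W σ x = 0

/-- **R3′ holds** (kernel-checked, rev 12; UNCONDITIONAL): `x ↦ W s (x + ℓe₃) - W s x` is real-analytic on `ℝ³` (tree
`analyticOnNhd_slice_univ`) and vanishes on the open patch, hence everywhere: the slice is exactly `ℓ`-periodic, and R3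
(`periodicSliceLiouville_holds`, with `isX3Periodic_neg` if `ℓ < 0`) kills the field.  Local coincidence ⇒ global periodicity ⇒ triviality. -/
theorem noLocalRepetition_holds : NoLocalRepetition := by
  intro K ℓ W U s hW hU hne hs hℓ hrep σ hσ x
  set e : E3 := ℓ • EuclideanSpace.single (2 : Fin 3) (1 : ℝ) with he
  have hsp : AnalyticOnNhd ℝ (W s) Set.univ := hW.analyticOnNhd_slice_univ hs
  have htr : AnalyticOnNhd ℝ (fun y : E3 => y + e) Set.univ := fun y _ => analyticAt_id.add analyticAt_const
  have hg : AnalyticOnNhd ℝ (fun y : E3 => W s (y + e) - W s y) Set.univ :=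
    (hsp.comp htr (fun y _ => Set.mem_univ _)).sub hsp
  obtain ⟨x₀, hx₀⟩ := hne
  have hev : (fun y : E3 => W s (y + e) - W s y) =ᶠ[𝓝 x₀] 0 := by
    filter_upwards [hU.mem_nhds hx₀] with y hy
    simp only [Pi.zero_apply, sub_eq_zero]
    exact hrep y hy
  have hz := hg.eqOn_zero_of_preconnected_of_eventuallyEq_zero isPreconnected_univ (Set.mem_univ x₀) hev
  have hper : IsX3Periodic ℓ (W s) := fun y => by
    have h0 := hz (Set.mem_univ y)
    simpa [sub_eq_zero] using h0
  rcases hℓ.lt_or_gt with hlt | hgt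
  · exact periodicSliceLiouville_holds K (-ℓ) W s hW (neg_pos.2 hlt) hs (isX3Periodic_neg hper) σ hσ x
  · exact periodicSliceLiouville_holds K ℓ W s hW hgt hs hper σ hσ x

/-- **Local-repetition sub-case of H′ SETTLED** (rev 12, unconditional): in the selected tube slice of a counterexample to H′ no two cells
are exact translates (along the axis) of each other on any open patch. -/
theorem isTubeSlice_no_local_repetition :
    ∀ (K ℓ : ℝ) (W : ℝ → E3 → E3) (U : Set E3) (s : ℝ), Literature.Analysis.FluidPDE.IsTypeIAncientMild K W →
      IsOpen U → U.Nonempty → s < 0 → ℓ ≠ 0 →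
      (∀ x ∈ U, W s (x + ℓ • EuclideanSpace.single (2 : Fin 3) (1 : ℝ)) = W s x) → ¬ IsTubeSlice (W s) := by
  intro K ℓ W U s hW hU hne hs hℓ hrep htube
  have h0 : W s = 0 := by
    funext x
    exact noLocalRepetition_holds K ℓ W U s hW hU hne hs hℓ hrep s hs x
  apply htube.2.2.2.1
  rw [h0]
  refine ⟨?_, ?_⟩ <;> simp

/-! #### §2h″ RUNG R7 «ONE CELL DETERMINES THE NECKLACE» + ETERNAL SYMMETRY (rev 13; UNCONDITIONAL): slice-germ rigidity.
Two Type-I ancient mild fields whose slices at ONE time agree on ONE non-empty open patch are EQUAL at all negative times: the germ of one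
cell at one instant determines every other cell and the whole history (slice analyticity ⇒ equal slices; forward: uniqueness of bounded
Oseen-mild solutions `oseenMild_bounded_unique` on the slab `(s, t/2) × ℝ³`; backward: time analyticity A).  With the class covariances of
the tree (`IsTypeIAncientMild.comp_add_right`, `stub_rotationCovariance` = `isTypeIAncientMild_conj_linearIsometryEquiv`) this gives ETERNAL
SYMMETRY: a symmetry under an affine isometry seen LOCALLY on ONE slice holds GLOBALLY at ALL times.  R3′, R4′ are shadows; new instances:
R3″ (local repetition in ANY direction kills, via the tree's any-direction periodic Liouville `periodicTypeIAncientLiouville`), R5′ (local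
axisymmetry of one slice + `r‖W‖ ≤ C` kills), R8-fin (twisted necklaces with a RATIONAL twist are dead); R8 (irrational twist) is OPEN. -/

/-- R7 — SLICE-GERM RIGIDITY. -/
def SliceGermRigidity : Prop :=
  ∀ (K₁ K₂ : ℝ) (W₁ W₂ : ℝ → E3 → E3) (U : Set E3) (s : ℝ), Literature.Analysis.FluidPDE.IsTypeIAncientMild K₁ W₁ →
    Literature.Analysis.FluidPDE.IsTypeIAncientMild K₂ W₂ → IsOpen U → U.Nonempty → s < 0 → (∀ x ∈ U, W₁ s x = W₂ s x) →
    ∀ σ : ℝ, σ < 0 → ∀ x, W₁ σ x = W₂ σ x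

/-- **R7 holds** (kernel-checked, rev 13). -/
theorem sliceGermRigidity_holds : SliceGermRigidity := by
  intro K₁ K₂ W₁ W₂ U s hW₁ hW₂ hU hne hs hgerm
  -- step 1: the two slices at time `s` agree everywhere (spatial analyticity)
  have hsp : AnalyticOnNhd ℝ (fun y : E3 => W₁ s y - W₂ s y) Set.univ :=
    (hW₁.analyticOnNhd_slice_univ hs).sub (hW₂.analyticOnNhd_slice_univ hs)
  obtain ⟨x₀, hx₀⟩ := hne
  have hev : (fun y : E3 => W₁ s y - W₂ s y) =ᶠ[𝓝 x₀] 0 := by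
    filter_upwards [hU.mem_nhds hx₀] with y hy
    simp only [Pi.zero_apply, sub_eq_zero]
    exact hgerm y hy
  have hz := hsp.eqOn_zero_of_preconnected_of_eventuallyEq_zero isPreconnected_univ (Set.mem_univ x₀) hev
  have hslice : W₁ s = W₂ s := funext fun y => by
    have h0 := hz (Set.mem_univ y)
    simpa [sub_eq_zero] using h0
  -- step 2: forward, by uniqueness of bounded Oseen-mild solutions on the slab `(s, t/2) × ℝ³`
  have hfwd : ∀ t : ℝ, s < t → t < 0 → W₁ t = W₂ t := by
    intro t hst ht
    have hT0 : t / 2 < 0 := by linarith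
    have htT : t < t / 2 := by linarith
    obtain ⟨M₁, hM₁⟩ := hW₁.isBoundedOn (δ := -(t / 2)) (by linarith)
    obtain ⟨M₂, hM₂⟩ := hW₂.isBoundedOn (δ := -(t / 2)) (by linarith)
    have hIio : ∀ τ ∈ Set.Ioo s (t / 2), τ ∈ Set.Iio (-(-(t / 2))) := fun τ hτ => by
      simp only [neg_neg, Set.mem_Iio]; exact hτ.2
    have hM0 : 0 ≤ max M₁ M₂ :=
      ((norm_nonneg _).trans (hM₁ t (by simp only [neg_neg, Set.mem_Iio]; exact htT) 0)).trans (le_max_left _ _)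
    have h1M : ∀ τ ∈ Set.Ioo s (t / 2), ∀ y, ‖W₁ τ y‖ ≤ max M₁ M₂ := fun τ hτ y =>
      (hM₁ τ (hIio τ hτ) y).trans (le_max_left _ _)
    have h2M : ∀ τ ∈ Set.Ioo s (t / 2), ∀ y, ‖W₂ τ y‖ ≤ max M₁ M₂ := fun τ hτ y =>
      (hM₂ τ (hIio τ hτ) y).trans (le_max_right _ _)
    have h1m := hW₁.aestronglyMeasurable_uncurry (s := s) hT0.le
    have h2m := hW₂.aestronglyMeasurable_uncurry (s := s) hT0.le
    have h1' : ∀ τ ∈ Set.Ioo s (t / 2), W₁ τ =ᵐ[volume] fun y =>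
        Literature.Analysis.UnboundedOperators.heatExtension (W₁ s) (τ - s) y - oseenDuhamel 1 s W₁ W₁ τ y :=
      fun τ hτ => Filter.Eventually.of_forall fun y => hW₁.mild_eq_heatExtension hτ.1 (hτ.2.trans hT0) y
    have h2' : ∀ τ ∈ Set.Ioo s (t / 2), W₂ τ =ᵐ[volume] fun y =>
        Literature.Analysis.UnboundedOperators.heatExtension (W₁ s) (τ - s) y - oseenDuhamel 1 s W₂ W₂ τ y :=
      fun τ hτ => Filter.Eventually.of_forall fun y => by
        rw [hslice]; exact hW₂.mild_eq_heatExtension hτ.1 (hτ.2.trans hT0) y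
    have hae := oseenMild_bounded_unique one_pos hM0 h1m h2m h1M h2M h1' h2' t ⟨hst, htT⟩
    exact (Continuous.ae_eq_iff_eq volume (hW₁.continuous_slice ht) (hW₂.continuous_slice ht)).1 hae
  -- step 3: backward, by time analyticity
  intro σ hσ x
  have han : AnalyticOnNhd ℝ (fun τ : ℝ => W₁ τ x - W₂ τ x) (Set.Iio 0) := fun τ hτ0 =>
    (typeIAncientMildTimeAnalytic_holds K₁ W₁ hW₁ x τ hτ0).sub (typeIAncientMildTimeAnalytic_holds K₂ W₂ hW₂ x τ hτ0)
  have hm : s / 2 ∈ Set.Iio (0 : ℝ) := by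
    simp only [Set.mem_Iio]; linarith
  have hev2 : (fun τ : ℝ => W₁ τ x - W₂ τ x) =ᶠ[𝓝 (s / 2)] 0 := by
    have hI : Set.Ioo s 0 ∈ 𝓝 (s / 2) := Ioo_mem_nhds (by linarith) (by linarith)
    filter_upwards [hI] with τ hτ
    simp only [Pi.zero_apply, sub_eq_zero]
    exact congr_fun (hfwd τ hτ.1 hτ.2) x
  have h0 := han.eqOn_zero_of_preconnected_of_eventuallyEq_zero isPreconnected_Iio hm hev2 hσ
  simpa [sub_eq_zero] using h0

/-- **ETERNAL SYMMETRY** (kernel-checked, rev 13; UNCONDITIONAL): for an affine isometry `g = (L, b)` of `ℝ³`, if ONE slice agrees with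
its `g`-conjugate `x ↦ L (W s (L⁻¹x + b))` on ONE non-empty open patch, then EVERY slice is globally `g`-symmetric
(R7 applied to the conjugated field, which is again Type-I ancient mild: `comp_add_right` + `stub_rotationCovariance`). -/
theorem isometryInvariant_allTime_of_local (K : ℝ) (W : ℝ → E3 → E3) (U : Set E3) (s : ℝ) (L : E3 ≃ₗᵢ[ℝ] E3) (b : E3)
    (hW : Literature.Analysis.FluidPDE.IsTypeIAncientMild K W) (hU : IsOpen U) (hne : U.Nonempty) (hs : s < 0)
    (hloc : ∀ x ∈ U, L (W s (L.symm x + b)) = W s x) :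
    ∀ σ : ℝ, σ < 0 → ∀ x, L (W σ (L.symm x + b)) = W σ x :=
  sliceGermRigidity_holds K K (fun t x => L (W t (L.symm x + b))) W U s
    (SymmetryModuliCountSymmetricLiouville.stub_rotationCovariance K L _ (hW.comp_add_right b)) hW hU hne hs hloc

/-- Instance: ONE slice LOCALLY invariant under a translation `b` ⇒ every slice globally `b`-invariant. -/
theorem translationInvariant_allTime_of_local (K : ℝ) (W : ℝ → E3 → E3) (U : Set E3) (s : ℝ) (b : E3)
    (hW : Literature.Analysis.FluidPDE.IsTypeIAncientMild K W) (hU : IsOpen U) (hne : U.Nonempty) (hs : s < 0)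
    (hloc : ∀ x ∈ U, W s (x + b) = W s x) :
    ∀ σ : ℝ, σ < 0 → ∀ x, W σ (x + b) = W σ x :=
  sliceGermRigidity_holds K K (fun τ y => W τ (y + b)) W U s (hW.comp_add_right b) hW hU hne hs hloc

/-- **R3″ — NO LOCAL REPETITION IN ANY DIRECTION** (kernel-checked, rev 13; UNCONDITIONAL): one slice coinciding with its translate by ANY
`e ≠ 0` on an open patch ⇒ `W ≡ 0` (eternal symmetry + the tree's any-direction periodic Type-I ancient Liouville
`SymmetryModuliCountSymmetricLiouville.periodicTypeIAncientLiouville`, PROVED — route SymmetryModuliCount's cone). -/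
theorem noLocalRepetition_anyDirection (K : ℝ) (W : ℝ → E3 → E3) (U : Set E3) (s : ℝ) (e : E3)
    (hW : Literature.Analysis.FluidPDE.IsTypeIAncientMild K W) (hU : IsOpen U) (hne : U.Nonempty) (hs : s < 0) (he : e ≠ 0)
    (hloc : ∀ x ∈ U, W s (x + e) = W s x) : ∀ σ : ℝ, σ < 0 → ∀ x, W σ x = 0 :=
  SymmetryModuliCountSymmetricLiouville.periodicTypeIAncientLiouville K W hW e he
    (translationInvariant_allTime_of_local K W U s e hW hU hne hs hloc)

/-- **R5′ — LOCAL AXISYMMETRY OF ONE SLICE IS ETERNAL** (kernel-checked, rev 13): if one slice is axisymmetric (about the `x₃`-axis) on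
an open patch, every slice is axisymmetric. -/
theorem isAxisymmetric_allTime_of_local (K : ℝ) (W : ℝ → E3 → E3) (U : Set E3) (s : ℝ)
    (hW : Literature.Analysis.FluidPDE.IsTypeIAncientMild K W) (hU : IsOpen U) (hne : U.Nonempty) (hs : s < 0)
    (hloc : ∀ (θ : ℝ), ∀ x ∈ U, rotZ θ (W s (rotZ (-θ) x)) = W s x) :
    ∀ σ : ℝ, σ < 0 → IsAxisymmetric (W σ) := by
  intro σ hσ θ y
  have h := isometryInvariant_allTime_of_local K W U s (rotZLIE θ) 0 hW hU hne hs
    (fun x hx => by simpa only [rotZLIE_apply, rotZLIE_symm_apply, add_zero] using hloc θ x hx) σ hσ (rotZ θ y)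
  simp only [rotZLIE_apply, rotZLIE_symm_apply, add_zero, ← rotZ_add, neg_add_cancel, rotZ_zero] at h
  exact h.symm

/-- R8 — TWISTED (SCREW-SYMMETRIC) NECKLACES: a Type-I ancient mild field invariant at all times under a screw motion
`x ↦ L x + b` (`L` a linear isometry fixing the non-zero axis vector `b`) vanishes.  OPEN RUNG for an irrational twist (plausible: the
screw group has compact quotient on every cylinder, so the zero-mean / heat-contraction argument of the periodic case should carry over);
the RATIONAL twist (finite-order `L`) is the theorem `screwSymmetricLiouville_finiteOrder` below. -/
def ScrewSymmetricLiouville : Prop :=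
  ∀ (K : ℝ) (W : ℝ → E3 → E3) (L : E3 ≃ₗᵢ[ℝ] E3) (b : E3), Literature.Analysis.FluidPDE.IsTypeIAncientMild K W → L b = b → b ≠ 0 →
    (∀ τ : ℝ, τ < 0 → ∀ x, W τ (L x + b) = L (W τ x)) → ∀ τ : ℝ, τ < 0 → ∀ x, W τ x = 0

/-- **R8 holds** (rev 16, 2026-08-29T04:55Z; UNCONDITIONAL, cited BY NAME): ns-net-p2 g7 landed
`Theorems.ScrewSymmetricLiouville.screwSymmetricLiouville` (file `ExtremiserTransienceScrewSymmetricLiouville.lean`: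
(C) near-axis lever `screwSymmetric_nearAxis_small` — KNSS blow-down + syndetic returns of `L^k` + the `x₂`-independent
Type-I-rate Liouville theorem; (B) symmetry-free BACKWARD-CONE PROPAGATION `exists_backwardCone_violator` (parabolic drift only,
no loss of level); (A) `eq_zero_of_small_nearOrigin`). So twisted necklaces with ANY screw (rational or irrational twist) are dead:
a tube slice invariant for all times under a screw motion `x ↦ Lx + b` (`Lb = b ≠ 0`) of a Type-I ancient mild field vanishes.
The «OPEN / heart-adjacent» label of card rev 15 is superseded. -/
theorem screwSymmetricLiouville_holds : ScrewSymmetricLiouville :=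
  Summit.NavierStokesRegularity.NavierStokesRegularity.Theorems.ScrewSymmetricLiouville.screwSymmetricLiouville

/-- **R8-fin holds** (kernel-checked, rev 13; UNCONDITIONAL): twisted necklaces with a RATIONAL twist (`L` of finite order `q`) are dead —
the `q`-th iterate of the screw is the translation by `q•b ≠ 0`, and the any-direction periodic Liouville theorem applies. -/
theorem screwSymmetricLiouville_finiteOrder :
    ∀ (K : ℝ) (W : ℝ → E3 → E3) (L : E3 ≃ₗᵢ[ℝ] E3) (b : E3) (q : ℕ), Literature.Analysis.FluidPDE.IsTypeIAncientMild K W →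
      L b = b → b ≠ 0 → 0 < q → (∀ x, (⇑L)^[q] x = x) →
      (∀ τ : ℝ, τ < 0 → ∀ x, W τ (L x + b) = L (W τ x)) → ∀ τ : ℝ, τ < 0 → ∀ x, W τ x = 0 := by
  intro K W L b q hW hLb hb hq hLq hsym
  -- iterating the screw: `W τ (Lⁿ x + n•b) = Lⁿ (W τ x)`
  have hit : ∀ τ : ℝ, τ < 0 → ∀ (n : ℕ) (x : E3), W τ ((⇑L)^[n] x + (n : ℝ) • b) = (⇑L)^[n] (W τ x) := by
    intro τ hτ n
    induction n with
    | zero => intro x; simp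
    | succ n ih =>
      intro x
      have h1 : (⇑L)^[n + 1] x + ((n + 1 : ℕ) : ℝ) • b = L ((⇑L)^[n] x + (n : ℝ) • b) + b := by
        rw [Function.iterate_succ_apply', map_add, L.map_smul, hLb]
        push_cast
        rw [add_smul, one_smul, add_assoc]
      rw [h1, hsym τ hτ, ih, Function.iterate_succ_apply']
  -- the `q`-th iterate is the translation by `q•b`
  have hper : ∀ τ < 0, ∀ x, W τ (x + (q : ℝ) • b) = W τ x := by
    intro τ hτ x
    have h := hit τ hτ q x
    rwa [hLq x, hLq (W τ x)] at h
  have hne : (q : ℝ) • b ≠ 0 := smul_ne_zero (Nat.cast_ne_zero.2 hq.ne') hb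
  intro τ hτ x
  exact SymmetryModuliCountSymmetricLiouville.periodicTypeIAncientLiouville K W hW _ hne hper τ hτ x

/-! ### §2i RUNG R5 «axisymmetric necklaces are dead» (rev 10; a by-name PLACEMENT edge onto PROVED KNSS Thm 5.3)

The most natural necklace — a chain of vortex rings / cells threaded on the `x₃`-axis, with or without swirl — is
AXISYMMETRIC.  That sub-case of H′ is already a theorem of the tree: KNSS 2009 Thm 5.3 (`knss_bound_C_over_r_holds`, PROVED)
kills bounded ancient mild axisymmetric fields with `r‖u‖ ≤ C`, and a Type-I ancient mild field is bounded-ancient-mild after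
any time shift (`isBoundedAncientMildSolution_sub`).  The hypothesis `r‖W‖ ≤ C` (decay away from the axis in axis-distance
units) is EXPLICIT here — natural for a necklace (cells within `O(√(-τ))` of the axis), not implied by the class; removing it
is KNSS Thm 6.2's blow-up-sequence step at the ancient level (not attempted).  Necklace brief item (f): the enemy is NOT
axisymmetric (about any axis, by `O(3)`-covariance of the class), and — symmetry being eternal (forward: rotation covariance +
uniqueness; backward: time analyticity A, as in R3) — no slice of it is. -/

/-- R5 — AXISYMMETRIC TYPE-I ANCIENT MILD FIELDS WITH `r‖W‖ ≤ C` VANISH (KNSS 2009 Thm 5.3 on time-shifts). -/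
def AxisymmetricTubeLiouville : Prop :=
  ∀ (K : ℝ) (W : ℝ → E3 → E3), Literature.Analysis.FluidPDE.IsTypeIAncientMild K W →
    (∀ τ : ℝ, τ < 0 → Literature.Analysis.FluidPDE.IsAxisymmetric (W τ)) →
    (∃ C : ℝ, ∀ τ : ℝ, τ < 0 → ∀ x, Literature.Analysis.FluidPDE.cylRadius x * ‖W τ x‖ ≤ C) →
    ∀ τ : ℝ, τ < 0 → ∀ x, W τ x = 0

/-- **R5 holds** (kernel-checked, rev 10): `knss_bound_C_over_r_holds` applied to the bounded time-shift `t ↦ W (t - (-τ/2))`,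
then a.e.-zero ⇒ zero by continuity of the slice. -/
theorem axisymmetricTubeLiouville_holds : AxisymmetricTubeLiouville := by
  intro K W hW haxi hC τ hτ x
  obtain ⟨C, hCb⟩ := hC
  set δ : ℝ := -τ / 2 with hδdef
  have hδ : 0 < δ := by rw [hδdef]; linarith
  have hu : Literature.Analysis.FluidPDE.IsBoundedAncientMildSolution 1 (fun t => W (t - δ)) :=
    hW.isBoundedAncientMildSolution_sub hδ
  have hlt : ∀ t : ℝ, t < 0 → t - δ < 0 := fun t ht => by linarith
  have hmeas : ∀ t < 0, MeasureTheory.AEStronglyMeasurable ((fun t => W (t - δ)) t) MeasureTheory.volume :=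
    fun t ht => (hW.continuous_slice (hlt t ht)).aestronglyMeasurable
  have hax : ∀ t < 0, Literature.Analysis.FluidPDE.IsAxisymmetric ((fun t => W (t - δ)) t) :=
    fun t ht => haxi (t - δ) (hlt t ht)
  have hbd : ∃ C : ℝ, ∀ t < 0, ∀ x, Literature.Analysis.FluidPDE.cylRadius x * ‖(fun t => W (t - δ)) t x‖ ≤ C :=
    ⟨C, fun t ht x => hCb (t - δ) (hlt t ht) x⟩
  have hae := Literature.Analysis.FluidPDE.knss_bound_C_over_r_holds hu hmeas hax hbd (τ + δ) (by rw [hδdef]; linarith)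
  have hcont : Continuous (W τ) := hW.continuous_slice hτ
  rw [add_sub_cancel_right] at hae
  have hzero : W τ = 0 := (Continuous.ae_eq_iff_eq MeasureTheory.volume hcont continuous_const).1 hae
  simp [hzero]

/-- Corollary (kernel-checked, UNCONDITIONAL): the axisymmetric-with-`r‖W‖ ≤ C` case of H′ is settled — such a field has no tube
slice at any time (it is zero). -/
theorem noFilamentTubeSliceAllTime_axisymmetric :
    ∀ (K A : ℝ) (W : ℝ → E3 → E3) (s : ℝ), Literature.Analysis.FluidPDE.IsTypeIAncientMild K W → s < 0 →
      (∀ τ : ℝ, τ < 0 → Literature.Analysis.FluidPDE.IsAxisymmetric (W τ)) →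
      (∃ C : ℝ, ∀ τ : ℝ, τ < 0 → ∀ x, Literature.Analysis.FluidPDE.cylRadius x * ‖W τ x‖ ≤ C) →
      (∀ τ : ℝ, τ < 0 → HasLinGrowth A (W τ)) → ¬ IsTubeSlice (W s) := by
  intro K A W s hW hs haxi hC _ htube
  have h0 : W s = 0 := by
    funext x
    exact axisymmetricTubeLiouville_holds K W hW haxi hC s hs x
  apply htube.2.2.2.1
  rw [h0]
  refine ⟨?_, ?_⟩ <;> simp

/-- **R5′ corollary** (kernel-checked, rev 13; UNCONDITIONAL): local axisymmetry of ONE slice + `r‖W‖ ≤ C` at all times ⇒ `W ≡ 0` (R5). -/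
theorem axisymmetricTubeLiouville_of_local :
    ∀ (K : ℝ) (W : ℝ → E3 → E3) (U : Set E3) (s : ℝ), Literature.Analysis.FluidPDE.IsTypeIAncientMild K W → IsOpen U → U.Nonempty →
      s < 0 → (∀ (θ : ℝ), ∀ x ∈ U, rotZ θ (W s (rotZ (-θ) x)) = W s x) →
      (∃ C : ℝ, ∀ τ : ℝ, τ < 0 → ∀ x, cylRadius x * ‖W τ x‖ ≤ C) → ∀ τ : ℝ, τ < 0 → ∀ x, W τ x = 0 :=
  fun K W U s hW hU hne hs hloc hC =>
    axisymmetricTubeLiouville_holds K W hW (isAxisymmetric_allTime_of_local K W U s hW hU hne hs hloc) hC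

/-- T2′ stub (provable). -/
/- T2′ is now a THEOREM of the tree (prover ns-net-p2 g6, p688614 `zoomPackageFlow`, 2026-08-29T02:32Z): discharged by name (rev 14). -/
theorem stub_zoomPackageFlow : ZoomPackageFlow :=
  Summit.NavierStokesRegularity.NavierStokesRegularity.Theorems.NearExtremalTransiencePerFlow.FilamentSelection.zoomPackageFlow

/-- G′ stub (provable). -/
/- G′ is now a THEOREM of the tree (prover ns-net-p2 g6, p687268 `growthTransferFlow`): discharged by name (rev 14). -/
theorem stub_growthTransferFlow : GrowthTransferFlow :=
  Summit.NavierStokesRegularity.NavierStokesRegularity.Theorems.NearExtremalTransiencePerFlow.FilamentSelection.growthTransferFlow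

/-- H′ stub (the heart, all-time form). -/
theorem stub_noFilamentTubeSliceAllTime : NoFilamentTubeSliceAllTime := by
  sorry

/-! ## §3 Composition (kernel-checked, no `sorry`): F1 → T1 → T2 → G → H → the crux BY NAME (T0 is the theorem of §1c) -/

/-- **LINE g9-β.**  δ's composition with T3 replaced by (F1 ⊕ G ⊕ H): the selected limit slice inherits the flow's filament budget. -/
theorem NearExtremalTransiencePerFlow_of_zoom
    (hF1 : Registered.stub_flowFilamentBudget)
    (hT1 : CoherentSelectionZoom)
    (hT2 : Registered.stub_zoomPackage)
    (hG : Registered.stub_growthTransfer)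
    (hH : Registered.stub_noFilamentTubeSlice) : NearExtremalTransiencePerFlow := by
  have hF1' : FlowFilamentBudget := hF1
  have hT0 : EfficientTimesNoDust := efficientTimesNoDust_holds
  have hT1' : CoherentSelectionZoom := hT1
  have hT2' : ZoomPackage := hT2
  have hG' : GrowthTransfer := hG
  have hH' : NoFilamentTubeSlice := hH
  intro C ν T hC hν hT u p hsol hLH hdec hrate hsing
  by_contra hno
  have hV : IsViolator C ν T u p := ⟨hC, hν, hT, hsol, hLH, hdec, hrate, hsing, hno⟩
  -- F1: the filament budget of the flow (physical units), eventually before `T`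
  obtain ⟨A, hA⟩ := hF1' C ν T hC hν hT u p hsol hLH hdec hrate
  -- T0: near-efficient late times with a Taylor bound
  obtain ⟨Θ, t, Mb, ε, hdata⟩ := hT0 C ν T u p hV
  -- T2: the NS-compatible zoomed slices form a near-extremal family and are zoom-compact
  obtain ⟨σ, Λ, Θ', ε', hσ, hfam, hcomp⟩ := hT2' C ν T u p hV Θ t Mb ε hdata
  -- T1: coherent selection of a member; its limit is extremal or a tube
  obtain ⟨y, φ, W₀, hφ, hconv, hdich⟩ := hT1' _ Λ Θ' ε' hfam hcomp
  -- T2 (compactness at the selected centres): the limit is a slice `W s` of a Type-I ancient mild field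
  obtain ⟨ψ, K, s, W, hψ, hW, hs, hconv'⟩ := hcomp y φ hφ
  have hWs : W s = W₀ :=
    funext fun z => tendsto_nhds_unique (hconv' z) ((hconv z).comp hψ.tendsto_atTop)
  subst hWs
  -- G: the selected limit slice inherits the filament budget with the same constant `A`
  have htT : Tendsto (fun n => t (σ n)) atTop (𝓝[<] T) := by
    have h1 : Tendsto (fun n => t (σ n)) atTop (𝓝 T) := hdata.2.1.comp hσ.tendsto_atTop
    exact tendsto_nhdsWithin_iff.2 ⟨h1, Eventually.of_forall fun n => (hdata.1 (σ n)).2⟩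
  have hAev : ∀ᶠ n in atTop, ∀ (x : E3) (r : ℝ), 0 < r →
      ∫ z in Metric.ball x r, ‖u (t (σ n)) z‖ ^ 2 ≤ A * ν ^ 2 * r := htT.eventually hA
  have hgrowth : HasLinGrowth A (W s) :=
    hG' ν A (fun n => u (t (σ n))) (fun n => Mb (σ n)) y φ (W s) hν (fun n => hdata.2.2.2.1 (σ n))
      (fun n => (hfam.1 n).continuous) (fun n z => hfam.2.2.1 n z) hAev hφ hconv
  rcases hdich with hext | htube
  · -- extremal branch (verbatim from δ): equality in the extended sharp inequality ⇒ plateau ⇒ `plateauSliceRigidity`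
    obtain ⟨hcd, hdiv, ⟨B, hB⟩, h1, h2, M, hM, hpos, hge⟩ := hext
    have hle := extendedSharp (W s) M B hcd hdiv hM hB h1 h2
    have hatt := le_antisymm hle hge
    have hint := ext_interior_contact_nonempty_of_extremal hcd hdiv hM hB h1 h2 hpos hatt
    have hvol : 0 < volume {x | ‖W s x‖ = M} :=
      lt_of_lt_of_le (isOpen_interior.measure_pos volume hint) (measure_mono interior_subset)
    have hMpos : 0 < M := by
      by_contra hM0
      push Not at hM0
      have hzp : 0 ≤ Real.sqrt (∫ x, ‖curl (W s) x‖ ^ 2) * Real.sqrt (∫ x, frobeniusNormSq (fderiv ℝ (curl (W s)) x)) :=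
        mul_nonneg (Real.sqrt_nonneg _) (Real.sqrt_nonneg _)
      have := mul_le_mul_of_nonneg_right hM0 hzp
      rw [mul_assoc] at hpos
      linarith
    have hcont : ContinuousOn (Function.uncurry W) (Set.Iio (0 : ℝ) ×ˢ Set.univ) := hW.continuousOn_uncurry
    have hmild : ∀ s t : ℝ, s < t → t < 0 → ∀ x, W t x = Literature.Analysis.FluidPDE.heatFlow (W s) (t - s) x -
        Literature.Analysis.FluidPDE.oseenDuhamel 1 s W W t x := hW.2.2.1
    have hdec' : ∀ t : ℝ, t < 0 → ∀ x, Real.sqrt (-t) * ‖W t x‖ ≤ K := by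
      intro t ht x
      have hsq : 0 < Real.sqrt (-t) := Real.sqrt_pos.2 (by linarith)
      have h := hW.norm_le ht x
      calc Real.sqrt (-t) * ‖W t x‖ ≤ Real.sqrt (-t) * (K / Real.sqrt (-t)) := by gcongr
        _ = K := by field_simp
    exact plateauSliceRigidity ⟨W, K, s, M, hcont, hmild, hdec', hs, hMpos, hM, hvol⟩
  · -- tube branch: the limit is a FILAMENT tube slice of a Type-I ancient mild field — excluded by H
    exact hH' K A W s hW hs hgrowth htube

/-! ## §3b ALL-TIME COMPOSITION (kernel-checked, no `sorry`): F1 → T1 → T2′ → G′ → H′ → the crux BY NAME -/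

/-- The registered-shape composition (T1 abstract): from the zoom form by `coherentSelectionZoom_of`. -/
theorem NearExtremalTransiencePerFlow_of
    (hF1 : Registered.stub_flowFilamentBudget)
    (hT1 : Registered.stub_coherentSelection)
    (hT2 : Registered.stub_zoomPackage)
    (hG : Registered.stub_growthTransfer)
    (hH : Registered.stub_noFilamentTubeSlice) : NearExtremalTransiencePerFlow :=
  NearExtremalTransiencePerFlow_of_zoom hF1 (coherentSelectionZoom_of hT1) hT2 hG hH

/-- **LINE g9-β, all-time form.**  As §3 with T2′/G′ delivering `HasLinGrowth A (W τ)` at every `τ < 0` and the weaker heart H′. -/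
theorem NearExtremalTransiencePerFlow_of_allTime_zoom
    (hF1 : Registered.stub_flowFilamentBudget)
    (hT1 : CoherentSelectionZoom)
    (hT2F : ZoomPackageFlow)
    (hGF : GrowthTransferFlow)
    (hHA : NoFilamentTubeSliceAllTime) : NearExtremalTransiencePerFlow := by
  have hF1' : FlowFilamentBudget := hF1
  have hT0 : EfficientTimesNoDust := efficientTimesNoDust_holds
  have hT1' : CoherentSelectionZoom := hT1
  intro C ν T hC hν hT u p hsol hLH hdec hrate hsing
  by_contra hno
  have hV : IsViolator C ν T u p := ⟨hC, hν, hT, hsol, hLH, hdec, hrate, hsing, hno⟩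
  obtain ⟨A, hA⟩ := hF1' C ν T hC hν hT u p hsol hLH hdec hrate
  obtain ⟨Θ, t, Mb, ε, hdata⟩ := hT0 C ν T u p hV
  obtain ⟨σ, Λ, Θ', ε', hσ, hfam, hcompF⟩ := hT2F C ν T u p hV Θ t Mb ε hdata
  -- slice-level zoom compactness of the family (the instance `τ = s` of the flow-level convergence)
  have hcompS : ZoomCompact (fun n y => (Mb (σ n))⁻¹ • u (t (σ n)) ((ν / Mb (σ n)) • y)) := by
    intro y φ hφ
    obtain ⟨ψ, K, s, W, hψ, hW, hs, -, hconvF⟩ := hcompF y φ hφ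
    refine ⟨ψ, K, s, W, hψ, hW, hs, fun z => ?_⟩
    simpa only [sub_self, mul_zero, add_zero] using hconvF s hs z
  obtain ⟨y, φ, W₀, hφ, hconv, hdich⟩ := hT1' _ Λ Θ' ε' hfam hcompS
  obtain ⟨ψ, K, s, W, hψ, hW, hs, hpin, hconvF⟩ := hcompF y φ hφ
  -- the slice family is the instance `τ = s` of the flow-level convergence
  have hconv' : ∀ z : E3, Tendsto (fun n => (Mb (σ (φ (ψ n))))⁻¹ •
      u (t (σ (φ (ψ n)))) ((ν / Mb (σ (φ (ψ n)))) • (y (φ (ψ n)) + z))) atTop (𝓝 (W s z)) := by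
    intro z
    have h1 := hconvF s hs z
    simpa only [sub_self, mul_zero, add_zero] using h1
  have hWs : W s = W₀ :=
    funext fun z => tendsto_nhds_unique (hconv' z) ((hconv z).comp hψ.tendsto_atTop)
  subst hWs
  -- G′ at every rescaled time
  have htT : Tendsto (fun n => t (σ (φ (ψ n)))) atTop (𝓝 T) :=
    hdata.2.1.comp ((hσ.comp (hφ.comp hψ)).tendsto_atTop)
  have hgrowthAll : ∀ τ : ℝ, τ < 0 → HasLinGrowth A (W τ) := by
    intro τ hτ
    exact hGF ν A T u (fun n => t (σ (φ (ψ n)))) (fun n => Mb (σ (φ (ψ n)))) (fun n => y (φ (ψ n))) s τ (W τ) hν hT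
      (fun n => hdata.2.2.2.1 _) (fun n => (hdata.1 _).2) htT
      (fun t' ht' => (hsol.contDiff_velocity ht').continuous) hA hs hpin hτ (hconvF τ hτ)
  rcases hdich with hext | htube
  · -- extremal branch (verbatim from §3)
    obtain ⟨hcd, hdiv, ⟨B, hB⟩, h1, h2, M, hM, hpos, hge⟩ := hext
    have hle := extendedSharp (W s) M B hcd hdiv hM hB h1 h2
    have hatt := le_antisymm hle hge
    have hint := ext_interior_contact_nonempty_of_extremal hcd hdiv hM hB h1 h2 hpos hatt
    have hvol : 0 < volume {x | ‖W s x‖ = M} :=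
      lt_of_lt_of_le (isOpen_interior.measure_pos volume hint) (measure_mono interior_subset)
    have hMpos : 0 < M := by
      by_contra hM0
      push Not at hM0
      have hzp : 0 ≤ Real.sqrt (∫ x, ‖curl (W s) x‖ ^ 2) * Real.sqrt (∫ x, frobeniusNormSq (fderiv ℝ (curl (W s)) x)) :=
        mul_nonneg (Real.sqrt_nonneg _) (Real.sqrt_nonneg _)
      have := mul_le_mul_of_nonneg_right hM0 hzp
      rw [mul_assoc] at hpos
      linarith
    have hcont : ContinuousOn (Function.uncurry W) (Set.Iio (0 : ℝ) ×ˢ Set.univ) := hW.continuousOn_uncurry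
    have hmild : ∀ s t : ℝ, s < t → t < 0 → ∀ x, W t x = Literature.Analysis.FluidPDE.heatFlow (W s) (t - s) x -
        Literature.Analysis.FluidPDE.oseenDuhamel 1 s W W t x := hW.2.2.1
    have hdec' : ∀ t : ℝ, t < 0 → ∀ x, Real.sqrt (-t) * ‖W t x‖ ≤ K := by
      intro t ht x
      have hsq : 0 < Real.sqrt (-t) := Real.sqrt_pos.2 (by linarith)
      have h := hW.norm_le ht x
      calc Real.sqrt (-t) * ‖W t x‖ ≤ Real.sqrt (-t) * (K / Real.sqrt (-t)) := by gcongr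
        _ = K := by field_simp
    exact plateauSliceRigidity ⟨W, K, s, M, hcont, hmild, hdec', hs, hMpos, hM, hvol⟩
  · -- tube branch: excluded by H′ with growth at ALL times
    exact hHA K A W s hW hs hgrowthAll htube

/-- The all-time composition with T1 abstract (registered stub): from the zoom form by `coherentSelectionZoom_of`. -/
theorem NearExtremalTransiencePerFlow_of_allTime
    (hF1 : Registered.stub_flowFilamentBudget)
    (hT1 : Registered.stub_coherentSelection)
    (hT2F : ZoomPackageFlow)
    (hGF : GrowthTransferFlow)
    (hHA : NoFilamentTubeSliceAllTime) : NearExtremalTransiencePerFlow :=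
  NearExtremalTransiencePerFlow_of_allTime_zoom hF1 (coherentSelectionZoom_of hT1) hT2F hGF hHA

/-- The all-time composition from the three new stubs and the two remaining canonical ones (sanity: elaborates). -/
theorem NearExtremalTransiencePerFlow_of_allTime_stubs : NearExtremalTransiencePerFlow :=
  NearExtremalTransiencePerFlow_of_allTime stub_flowFilamentBudget_holds stub_coherentSelection_holds
    stub_zoomPackageFlow stub_growthTransferFlow stub_noFilamentTubeSliceAllTime

end Summit.NavierStokesRegularity.NavierStokesRegularity.Cruxes.NearExtremalTransiencePerFlow.FilamentSelection
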